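import Literature.MathematicalPhysics.QuantumFieldTheory.BalabanImbrieJaffe1984to88.BIJ85Eq632MeanFieldAction
import Literature.MathematicalPhysics.QuantumFieldTheory.BalabanImbrieJaffe1984to88.BIJ85BlockAveragesTorus

/-!
# `BalabanImbrieJaffe1984to88.BIJ85Eq61MeanFieldRT` — T. Bałaban, J. Imbrie, A. Jaffe, *Renormalization of the Higgs model: minimizers,
propagators and the stability of mean field theory*, Commun. Math. Phys. **97** (1985) 299–329 [BalabanImbrieJaffe1985], **(6.1)** p. 318:
the `(k+1)`-th renormalization transformation APPLIED TO `e^{−S_k}` — r18's typed transformation `BIJ88RenormTransf311.IsRT311`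
([BalabanImbrieJaffe1988] (3.11) = [BalabanImbrieJaffe1985] (3.3) with the axial gauge `δ_{Ax}` and the Gaussian `δ_H`) INSTANTIATED AT
PRINT'S INTEGRAND: block average `Qu` (2.10), scalar average `Q(u_k)φ` with the actual background `u_k` (4.5.4), and `S_k` = THE MEAN FIELD
ACTION (4.1) OF RECORD `BIJ85MeanFieldAction41.meanFieldAction` BY NAME.

statement-level skeleton of published theorems with citation tags; proofs where landed; nothing here is a claim about the Yang–Mills mass gap

PDF held: `paper:balaban1985-cmp97-bij-higgs-minimizers` (journal page = PDF page + 298); p. 318 [PDF 20] READ AS AN IMAGE this session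
(`HOME/lit-balaban-r15/pages/1985-cmp97-bij-higgs-minimizers-p020-x2.png`; the text layer garbles the display), pp. 313, 320 [PDF 15, 22]
likewise (`…-p015-x2.png`, `…-p022-x2.png`).

CITATION HEADER (lean-in-tree rule).  Part of the lit-balaban TYPED SKELETON (HOME `run/shared/lean/pub/lit-balaban/`), PHASE-2 proof seat
p30 (gen 33; free-target protocol G.5-34(d): target (μ) of the row owner r15 g16's «TWO FREE S TARGETS» 2026-08-23T13:26:52Z, lead g12 HEAD
WORDS Q32; TAKING line HOME/STATUS.md 2026-08-23T14:17:09Z).  Serves row `C1.Eq6.1-6.4` of `HOME/lit-balaban-r15/ROWS-C1.md`, display (6.1)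
((6.2)–(6.4) are r15's `BIJ85SmallFieldSplit64`, not restated).  Nothing of r18's (3.11)/(3.13) (`BIJ88RenormTransf311`), of p34's existence
bridge (`BIJ88RT311Exists`), of r18's block averages (`BIJ85BlockAveragesTorus`), of r15's (4.1) (`BIJ85MeanFieldAction41`) or of r13's (6.3.2)
(`BIJ85Eq632MeanFieldAction`) is re-declared or restated: they are consumed BY NAME.

THE PRINTED TEXT (p. 318 [PDF 20], verbatim).  *"In (4.1) we ignore the small corrections due to interactions and concentrate on the quadratic
terms. Hence the result of this section is to justify our (otherwise ad hoc) choice of σ_k and Δ_k(u_k) as the mean field quadratic forms for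
the kth effective action.  In accord with the notation of Sect. 3 we denote the variables in S_k as u and φ which take their values on the unit
lattice. Thus we study  ∫𝒟u𝒟φ δ(v/Qu)δ_{Ax}(u) exp[−½a‖ψ − Q(u_k)φ‖² − S_k(u, φ)]. (6.1)  In this integral we perform a preparatory
translation … Let v denote the average gauge field on the L-lattice … The integral (6.1) will be studied in detail in later papers by dividing
it into small and large field regions, defined by some restrictions on the range of φ and u."*

READING (recorded for the row owner and the referees; nothing below is asserted beyond what the kernel checks).
* `u, φ` = the unit-lattice fields of the `k`-th step = the torus level `0 + k` of the Sect. 4.6 / 7.3 scalar-field files (`GaugeField P (0+k) U1`,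
  `HiggsField P (0+k)`); `v, ψ` = the `L`-lattice fields = level `0 + k + 1`.  *"In accord with the notation of Sect. 3"*: `δ(v/Qu)` with the
  nonlinear average `Qu` (2.10) = r18's `BIJ85BlockAveragesTorus.qU`; `δ_{Ax}(u)` (3.4) = r18's `axialMeasure`, which is INSIDE the defining
  integral of `IsRT311` (lead's check (i)); the Gaussian `exp[−½a‖ψ − Q(u_k)φ‖²]` = the normalized `δ_H` of (3.6), r18's `gaussWeight a`
  (the tree's (3.11) normalization `aL⁻²⟨·,·⟩` with `E^{(0)}` (3.12); print's (6.1) carries no normalization constant).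
* `u_k` = THE ACTUAL BACKGROUND (4.5.4) computed from the integration variable `u` (p. 320 (6.2.1): *"Rewrite the definition of u_k (with u in
  place of v)"*): p33's `BIJ85Eq454PlaqResidual.actualBgU1` at the index's `v :=` `u` read back on `U1Field P k` (`vOf`, the inverse of
  p33's level transport `BIJ85Claim73SecondForm.vK`: `vK_vOf`, `vOf_vK`).
* `Q(u_k)φ` = the one-step covariant average (2.6) of the unit-lattice field `φ` whose transports `u_k(Γ_{yx})` are taken, per (2.5)
  *"u(Γ) = Π_{b∈Γ} u_b"*, along the `η`-bonds of the unit-lattice contour `Γ_{yx}` — i.e. (2.6) with the unit-bond field `ū_k(b) = u_k(⟨b₋, b₊⟩)`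
  ([BalabanImbrieJaffe1988] (4.4)), p11's `lineIter u_k k`: `qH = qCov (lineIter u_k k)`.  This IS the top factor of p11's `Q_{k+1}(u_k) =
  Q(u_k^{(k)}) ∘ Q_k(u_k)` (`qH_qCovK`, p11's `qCovK_succ`), the composition Sect. 6.3 uses.
* `S_k(u, φ)` = r15's `meanFieldAction a ha i φ` BY NAME (lead's check (ii); `Sk_eq`), `i = idx u` the index of p33's `AllIdx` carrying THIS
  torus, scale `k`, coupling `e_k` and `v := u`; print: *"In (4.1) we ignore the small corrections due to interactions"* — the interaction terms
  are not an object of this paper and are not typed (as in `BIJ85MeanFieldAction41`).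

WHAT IS DEFINED (definitions with bodies) / PROVED (0 `sorry`, standard axioms, no `Prop`-valued fact).
* §0–§1 level transport `vOf` (+ `vK_vOf`, `vOf_vK`, `vOf_gaugeAct`), the step data `Step61` (torus, `1 ≤ k`, `k + 1 ≤ m + K`, `0 < e_k ≤ 1`),
  the index `Step61.idx u`, the background `Step61.uk u = u_k(u)` and its closed form `uk_eq` ((4.5.4) via p33's `actualBgU1_eq`).
* §2 THE OBJECTS OF (6.1): `Step61.qH u φ = Q(u_k)φ`, `Step61.Sk a ha u φ = S_k(u, φ)` (`Sk_eq`: `meanFieldAction` by name, `rfl`),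
  `Step61.rho = e^{−S_k}`; kernels `qH_apply` ((2.6) with the transports of `u_k`), `qH_qCovK`, `norm_rho`, `norm_rho_le_one` (`S_k ≥ 0`).
* §3 MEASURABILITY of the integrand in `(u, φ)`: `measurable_uk` (the branch (2.11) of `f^{(k)}` is a measurable discontinuity, r18's
  `measurable_argB`; `T_k`, `Q^{s*}_k` by name), `measurable_qH`, `measurable_Sk`, `measurable_rho` — the scalar part `½⟨φ, Δ_k(u_k)φ⟩` is
  handled WITHOUT the chosen inverse `G_k(u_k)`: it is the MINIMUM of the form (3.25)/(4.6.1) (p11/p30's `scalarForm_phiCl`, `isMinOn_phiCl`),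
  `scalarPart_idx_eq_iInf`, an infimum of jointly measurable functions over a dense sequence.
* §4 JOINT GAUGE INVARIANCE of the integrand (p. 306: *"They generate the gauge group of the integral 𝒯(exp −S)"*): `Sk_gaugeAct` /
  `jointInvariant_rho` = (ν), r13's `meanFieldAction_gaugeIdx` ((6.3.2) for `meanFieldAction`) BY NAME through the `vK` dictionary
  (`idx_gaugeAct`); `uk_gaugeAct` (r13's `actualBgU1_gaugeU`: `u_k(u^g) = (u_k(u))^{g∘B^k}`), `qH_gaugeAct` ((2.8) for `Q(u_k)`),
  `gaussWeight_twist`, and `integrand61_gaugeAct`: the whole integrand `e^{−S_k}·δ_H` is invariant under `(u, φ, ψ) ↦ (u^g, gφ, (g∘corner)ψ)`.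
* §5 **(6.1) TYPED AND INHABITED** = r18's `IsRT311 qU (Q(u_k)·) a ρ ρ₁` at print's data: `exists_isRT311_of_integrable_ax` (p34's
  `isRT311_rt_of_integrable_ax` over `axialRTData` with r18's Haar law `absolutelyContinuous_map_qU`: ANY measurable density integrable in the axial
  gauge has a `dv dψ`-integrable transform `ρ₁ = 𝒯ρ` of (3.3) satisfying (6.1)); for `ρ = e^{−S_k}`: `exists_isRT311_eq61_of_integrable_ax` /
  `exists_isRT311_eq61_of_integrable` (premise: integrability of `e^{−S_k}` in the axial gauge / plainly — HONEST SCOPE); **HYPOTHESIS-FREE on a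
  small-field region** (p. 318 *"dividing it into small and large field regions, defined by some restrictions on the range of φ and u. In this paper
  we are concerned with the small field regions"*): `isRT311_eq61_smallField` — for every measurable restriction `χ(u, φ)`, `|χ| ≤ 1`, of bounded
  `φ`-range, `𝒯(χe^{−S_k})` exists and satisfies (6.1) (`integrable_smallField_ax`: `e^{−S_k} ≤ 1`, `𝒟u` a probability measure, a bounded box);
  `integral_rho1_eq61` — (3.7) *"∫𝒯e^{−S}𝒟v𝒟ψ = ∫e^{−S}𝒟u𝒟φ"* for every `ρ₁` that (6.1) defines (r18's `integral_eq_of_isRT311`).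
* §6 **PRINT'S (6.1) CONVERGES**: `integrable_integrand61` — for EVERY `u` and `ψ` the `φ`-integrand `e^{−S_k(u,φ)}δ_H(ψ − Q(u_k)φ)` is
  `𝒟φ`-integrable: the confining form `½⟨φ, Δ_k(u_k)φ⟩ + t‖Q(u_k)φ‖²` is positive definite (`eq_zero_of_scalarPart_eq_zero`: a vanishing minimum
  of (4.6.1) makes the minimizer `ψ_k` covariantly constant with `Q_kψ_k = φ`, and `Q(u_k)Q_k(u_k) = Q_{k+1}(u_k)` kills no covariantly constant field —
  p11's `eq_zero_of_covD_eq_zero_of_qCovK_eq_zero` at level `k + 1`), hence coercive (`cForm_coercive`), and the integrand is dominated by a product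
  of one-site Gaussians (`gaussWeight_le`).

C2 CURRENCY (for the (3.11)/(5.1.1) row owner r18; a remark, no identity claimed).  [BalabanImbrieJaffe1988] (5.1.1)'s `Q(u_k)φ` of record is
`qCov (barU k u_k) φ` with r18's (4.4) `BIJ88Sect4Statements.barU` = B4's CENTRED straight lines `AveragingRT.axialAvg`; (2.6) of THIS paper transports
from the block CORNER (2.4) *"y = Ln denotes a corner of a block"* — p11's `lineU`/`lineIter`, the factorisation `Q_{k+1} = Q(u^{(k)}) ∘ Q_k`
(`qCovK_succ`).  The two unit-bond fields are products of `u_k` along different straight segments (centre-to-centre vs corner-to-corner); on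
pull-backs both return the unit-lattice field (p34's `BIJ88RT51Background.barU_qsstarGIter0`, p33's `lineIter_qsstarGIter`); no dictionary
`lineIter ↔ barU` is asserted here.

HONEST SCOPE (the located gap; HOME/GAPS.md G-C1-09 filed with this proposal).  The existence route of the tree (p34's Radon–Nikodym transform)
needs the `𝒟u𝒟φ`-INTEGRABILITY of `ρ₀ = e^{−S_k(u, φ)}` (in the axial gauge) for the MEAN-FIELD `S_k` ALONE; §5 keeps it as the HYPOTHESIS `hI` for
the unrestricted density and DISCHARGES it for every small-field restriction of bounded `φ`-range.  For the unrestricted density it is NOT a consequence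
of the printed stability (7.3.2) / `meanFieldAction_stability` (that lower bound carries `−Me_k^{2−α}Σ_x|φ(x)|²` and holds under (7.3.1) only), and
print does not assert it: `φ ↦ e^{−½⟨φ, Δ_k(u_k)φ⟩}` is a centred Gaussian whose `𝒟φ`-mass is finite iff `Δ_k(u_k(u))` has no zero mode (iff
`u_k(u)` admits no covariantly constant section), and the `𝒟u`-integrability of that mass is a statement about `det Δ_k(u_k(u))⁻¹` found nowhere in
[BalabanImbrieJaffe1985].  Print's own (6.1) converges for every `(u, ψ)` because `δ_H` supplies `½a‖ψ − Q(u_k)φ‖²` — PROVED, §6; the push-forward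
identity `IsRT311` tested against `g ≡ 1` is the stronger, normalizable statement.  Also not typed: the interaction terms of (4.1); (6.2)–(6.4) (r15).
Imports: Literature + Mathlib only.
-/

namespace Literature.MathematicalPhysics.QuantumFieldTheory.BalabanImbrieJaffe1984to88.BIJ85Eq61MeanFieldRT

open Literature.MathematicalPhysics.QuantumFieldTheory.Balaban1983to89 hiding Site Plaq
open Balaban1983to89 renaming Site → TSite, Plaq → TPlaq
open B7SectAStatements (blockOfIter)
open BIJ88Sect3Statements (U1 toC cfg plaqVar plaqVar_cfg)
open BIJ88Sect3Rescaling (circleEquivU1 coe_circleEquivU1_symm fieldEquiv)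
open BIJ85Sect1Model (U1Field HiggsField gaugeU plaq)
open BIJ85RT33 (JointInvariant twist twist_apply measurable_toC gaugeInvariant_integral)
open BIJ88RenormTransf311 (IsRT311 axialBonds gaussWeight integral_eq_of_isRT311)
open BIJ88RT311Exists (axialRTData gaussApprox isRT311_axialRTData isRT311_rt_of_integrable_ax integrable_rt_of_integrable_ax
  ax_eq_fixBonds)
open T4AxialGaugeFixing (fixBonds measurable_fixBonds)
open BIJ85RT37Normalization (integrable_comp_ax)
open BIJ85BlockAveragesTorus (qU qCov qCov_apply measurable_qU measurable_qCov absolutelyContinuous_map_qU holC measurable_holC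
  measurable_toC_apply expU1 measurable_expU1 measurable_argB corner qCov_gaugeAct_twist)
open BIJ85BlockAveragesTorusK (lineU lineIter runProd holCK holCK_zero holCK_succ qCovK qCovK_succ qCovK_apply CoarseSpK QlinK
  scalarForm_torusK cornerIter blkIter_cornerIter lineIter_gaugeAct)
open BIJ85ScalarPropagatorTorus (FineSp Dlin)
open BIJ85ScalarPropagatorTorusK (eq_zero_of_covD_eq_zero_of_qCovK_eq_zero)
open BIJ85ScalarForm464 (scalarForm opT deltaOp phiCl scalarForm_phiCl isMinOn_phiCl)
open BIJ85Eq453GaugeField (qsstarG qsstarG_apply qsstarGIter)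
open BIJ85Eq454PlaqResidual (actualBgU1 toC_plaqHol_fieldEquiv)
open BIJ85Ineq732Background (phase blkIter_eq_blockOfIter)
open BIJ85Claim73SecondForm (lvl vK actualBgU1_eq)
open BIJ85Claim73AllCouplings (AllIdx allStabData allG allG_spec)
open BIJ85SmallFieldSplit64 (plaqField)
open BIJ85Sigma421Torus (UnitPlaqSpace toU sigmaTorus)
open BIJ85Ineq732Flat (cPhys cPhys_pos)
open BIJ85Sect4Statements (aK)
open BIJ88Eq541Base0 (TkF)
open BIJ85MeanFieldAction41 (fk sigmaK gaugePart scalarPart meanFieldAction gaugePart_nonneg)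
open BIJ85Eq632MeanFieldAction (siteK transfK gaugeIdx vK_gaugeU meanFieldAction_gaugeIdx actualBgU1_gaugeU transfK_blockOfIter_cornerIter)
open GaugeField (gaugeAct GaugeInvariant)
open scoped BigOperators RealInnerProductSpace
open _root_.MeasureTheory Complex Function

noncomputable section

variable {P : Params}

/-! ## §0  Level transport `0 + k ↔ k` (the unit lattice `T₁^{(k)}` of the scalar-field files is the level `0 + k`) -/

/-- kernel: transporting a configuration along `n = n'` and back is the identity. [cite: BalabanImbrieJaffe1985, (2.1) p.302] -/
theorem lvl_symm_lvl {G : Type*} {n n' : ℕ} (h : n = n') (V : GaugeField P n G) : lvl h.symm (lvl h V) = V := by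
  subst h; rfl

/-- kernel: the same in the other order. [cite: BalabanImbrieJaffe1985, (2.1) p.302] -/
theorem lvl_lvl_symm {G : Type*} {n n' : ℕ} (h : n = n') (V : GaugeField P n' G) : lvl h (lvl h.symm V) = V := by
  subst h; rfl

/-- kernel: level transport is measurable (it is the identity along `n = n'`). [cite: BalabanImbrieJaffe1985, (2.1) p.302] -/
theorem measurable_lvl {G : Type*} [MeasurableSpace G] {n n' : ℕ} (h : n = n') :
    Measurable (lvl (P := P) (G := G) h) := by
  subst h; exact measurable_id

/-- a site of `T₁^{(k)}` read at the level `0 + k` (inverse of r13's `siteK`). [cite: BalabanImbrieJaffe1985, (2.1) p.302] -/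
def siteK' (k : ℕ) (z : TSite P k) : TSite P (0 + k) := cast (congrArg (TSite P) (Nat.zero_add k).symm) z

/-- kernel: a cast along `n = n'` followed by the cast back is the identity. [folklore] -/
private theorem cast_cast_site {n n' : ℕ} (h : n = n') (y : TSite P n) :
    cast (congrArg (TSite P) h.symm) (cast (congrArg (TSite P) h) y) = y := by
  subst h; rfl

/-- kernel: `siteK' ∘ siteK = id`. [cite: BalabanImbrieJaffe1985, (2.1) p.302] -/
@[simp] theorem siteK'_siteK (k : ℕ) (y : TSite P (0 + k)) : siteK' k (siteK k y) = y := cast_cast_site (Nat.zero_add k) y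

/-- kernel: `siteK ∘ siteK' = id`. [cite: BalabanImbrieJaffe1985, (2.1) p.302] -/
@[simp] theorem siteK_siteK' (k : ℕ) (z : TSite P k) : siteK k (siteK' k z) = z := cast_cast_site (Nat.zero_add k).symm z

/-- a gauge transformation `g : T₁^{(k)} → U(1)` (2.7) given on the `U1` carrier at the level `0 + k` (the currency of `JointInvariant` /
`IsRT311`), read on `T₁^{(k)} → Circle` (the currency of r13's (6.3.2) `gaugeIdx`). [cite: BalabanImbrieJaffe1985, (2.7) p.303] -/
def gcOf (k : ℕ) (g : GaugeTransf P (0 + k) U1) : TSite P k → Circle := fun z => circleEquivU1.symm (g (siteK' k z))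

/-- kernel: r13's `transfK` inverts `gcOf`. [cite: BalabanImbrieJaffe1985, (2.7) p.303] -/
theorem transfK_gcOf (k : ℕ) (g : GaugeTransf P (0 + k) U1) : transfK k (gcOf k g) = g := by
  funext y
  simp only [transfK, gcOf, siteK'_siteK, MulEquiv.apply_symm_apply]

/-- **the integration variable `u` of (6.1) as the index's unit-lattice field `v`** (p. 320: *"with u in place of v"*): `u` on the `U1` carrier
at the level `0 + k`, read back on `U1Field P k` — the inverse of p33's `vK k`. [cite: BalabanImbrieJaffe1985, (6.1) p.318] -/
def vOf (k : ℕ) (u : GaugeField P (0 + k) U1) : U1Field P k := fieldEquiv.symm (lvl (Nat.zero_add k) u)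

/-- kernel: `vK k (vOf k u) = u`. [cite: BalabanImbrieJaffe1985, (6.1) p.318] -/
@[simp] theorem vK_vOf (k : ℕ) (u : GaugeField P (0 + k) U1) : vK k (vOf k u) = u := by
  unfold vK vOf
  rw [Equiv.apply_symm_apply]
  exact lvl_symm_lvl _ u

/-- kernel: `vOf k (vK k v) = v`. [cite: BalabanImbrieJaffe1985, (6.1) p.318] -/
@[simp] theorem vOf_vK (k : ℕ) (v : U1Field P k) : vOf k (vK k v) = v := by
  unfold vK vOf
  rw [lvl_lvl_symm, Equiv.symm_apply_apply]

/-- kernel: **(2.7) through the dictionary** — `vOf k (u^g) = (vOf k u)^{g}` with `g` read on `Circle` (r13's `vK_gaugeU`, inverted).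
[cite: BalabanImbrieJaffe1985, (2.7) p.303] -/
theorem vOf_gaugeAct (k : ℕ) (g : GaugeTransf P (0 + k) U1) (u : GaugeField P (0 + k) U1) :
    vOf k (gaugeAct g u) = gaugeU (gcOf k g) (vOf k u) := by
  have h := vK_gaugeU k (gcOf k g) (vOf k u)
  rw [transfK_gcOf, vK_vOf] at h
  rw [← h, vOf_vK]

/-- kernel: a plaquette variable of `vOf k u`, read in `ℂ`, is r18's `plaqVar` of the transported configuration (p34's `toC_plaqHol_fieldEquiv`,
r18's `plaqVar_cfg`). [cite: BalabanImbrieJaffe1985, (2.5) p.302] -/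
theorem coe_plaq_vOf (k : ℕ) (u : GaugeField P (0 + k) U1) (p : TPlaq P k) :
    ((plaq (vOf k u) p : Circle) : ℂ) = plaqVar (cfg (lvl (Nat.zero_add k) u)) p := by
  unfold vOf
  rw [← toC_plaqHol_fieldEquiv, Equiv.apply_symm_apply, plaqVar_cfg]

/-! ## §1  The data of one step, the index, the actual background `u_k(u)` (4.5.4) -/

/-- THE DATA OF THE `k`-TH STEP (6.1): a torus of record with `d ≥ 2`, a scale `1 ≤ k` with `k + 1 ≤ m + K` (the step maps level `0 + k` to
level `0 + k + 1`), and the coupling `0 < e_k ≤ 1` of (4.2.4). [cite: BalabanImbrieJaffe1985, (6.1) p.318] -/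
structure Step61 (P : Params) where
  hd2 : 2 ≤ P.d
  k : ℕ
  hk1 : 1 ≤ k
  hk : k + 1 ≤ P.m + P.K
  e : ℝ
  he : 0 < e
  he1 : e ≤ 1

namespace Step61

variable (s : Step61 P)

/-- kernel: the standing range of the scalar-field files, `k ≤ m + K`. [cite: BalabanImbrieJaffe1985, (4.5.4) p.313] -/
theorem hk' : s.k ≤ P.m + P.K := by have := s.hk; omega

/-- kernel: the same at the level `0 + k`. [cite: BalabanImbrieJaffe1985, (4.5.4) p.313] -/
theorem hk0 : 0 + s.k ≤ P.m + P.K := by have := s.hk; omega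

/-- kernel: the standing range of the renormalization step `0 + k → 0 + k + 1`. [cite: BalabanImbrieJaffe1985, (6.1) p.318] -/
theorem hj : 0 + s.k + 1 ≤ P.m + P.K := by have := s.hk; omega

/-- the index of p33's family of ALL actual Sect. 7.3 data carrying this torus, the scale `k`, the coupling `e_k` and a unit-lattice field `v`.
[cite: BalabanImbrieJaffe1985, (7.3.1) p.326] -/
def idxV (v : U1Field P s.k) : AllIdx P.d P.L where
  P := P
  hd := rfl
  hL := rfl
  hd2 := s.hd2
  k := s.k
  hk1 := s.hk1
  hk := s.hk'
  e := s.e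
  he := s.he
  he1 := s.he1
  v := v

/-- kernel: r13's gauge transformation of the data (2.7) acts on the field slot: `gaugeIdx (idxV v) g = idxV (v^g)`, by `rfl`.
[cite: BalabanImbrieJaffe1985, (2.7) p.303] -/
theorem gaugeIdx_idxV (v : U1Field P s.k) (g : TSite P s.k → Circle) : gaugeIdx (s.idxV v) g = s.idxV (gaugeU g v) := rfl

/-- **the index of ALL actual Sect. 7.3 data at which `S_k(u, ·)` is evaluated**: this torus, the scale `k`, the coupling `e_k`, and the unit-lattice
field `v := u` (p33's `AllIdx`). [cite: BalabanImbrieJaffe1985, (6.1) p.318] -/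
def idx (u : GaugeField P (0 + s.k) U1) : AllIdx P.d P.L := s.idxV (vOf s.k u)

/-- kernel: the index's unit-lattice field IS the integration variable `u` (on the `U1` carrier: p33's `vK`). [cite: BalabanImbrieJaffe1985, (6.1) p.318] -/
theorem vK_idx_v (u : GaugeField P (0 + s.k) U1) : vK s.k (s.idx u).v = u := vK_vOf s.k u

/-- **`u_k = u_k(u)`**, the actual background (4.5.4) computed from the integration variable `u` (p33's `actualBgU1`; = `(s.idx u).U`, `rfl`).
[cite: BalabanImbrieJaffe1985, (4.5.4) p.313] -/
def uk (u : GaugeField P (0 + s.k) U1) : GaugeField P 0 U1 := actualBgU1 s.hd2 s.k s.e (vOf s.k u)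

/-- kernel: `uk u` is the index's background `AllIdx.U`. [cite: BalabanImbrieJaffe1985, (4.5.4) p.313] -/
theorem idx_U (u : GaugeField P (0 + s.k) U1) : (s.idx u).U = s.uk u := rfl

/-- **`G_k(u_k(u))`**: THE inverse (4.6.2) `[D_{u_k}^*D_{u_k} + a_kQ_k(u_k)^*Q_k(u_k)]^{−1}` chosen by p33's `allG` at the index, read on this torus's
carriers (`= allG a ha (s.idx u)`, `rfl`). [cite: BalabanImbrieJaffe1985, (4.6.2) p.313] -/
def Gk (a : ℝ) (ha : 0 < a) (u : GaugeField P (0 + s.k) U1) : FineSp P 0 →ₗ[ℝ] FineSp P 0 := allG a ha (s.idx u)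

/-- kernel: `G_k(u_k(u))` is a right inverse of `D^*D + a_kQ_k^*Q_k` at `u_k(u)` (p33's `allG_spec`). [cite: BalabanImbrieJaffe1985, (4.6.2) p.313] -/
theorem Gk_spec (a : ℝ) (ha : 0 < a) (u : GaugeField P (0 + s.k) U1) (φ : FineSp P 0) :
    opT (Dlin (cPhys P s.k) (s.uk u)) (QlinK (s.uk u) s.k) (aK a P.L s.k) (s.Gk a ha u φ) = φ :=
  allG_spec a ha (s.idx u) φ

/-- kernel: **(4.5.4) for `u_k(u)` in closed form** — `u_k(u)_b = (Q^{s*}_ku)_b · exp[−ie_kη(T_kf^{(k)})_b]` with p31's pull-back `qsstarGIter`, p31's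
`T_k = 𝒟_k∂^*Q^{e*}_k` (`TkF`) and `f^{(k)} = (ie_k)^{−1}ln u(∂·)` (`plaqField`) (p33's `actualBgU1_eq` + `vK_vOf`). [cite: BalabanImbrieJaffe1985, (4.5.4) p.313] -/
theorem uk_eq (u : GaugeField P (0 + s.k) U1) :
    s.uk u = fun b => qsstarGIter s.k u b *
      phase (fun b => (s.e * P.eta s.k) * -TkF P s.hd2 ((P.eta s.k) ^ P.d) (P.eta s.k) s.k (plaqField s.e (vOf s.k u)) b) b := by
  rw [uk, actualBgU1_eq, vK_vOf]

/-! ## §2  The objects of (6.1): `Q(u_k)φ`, `S_k(u, φ)`, `e^{−S_k(u, φ)}` -/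

/-- **`Q(u_k)φ` of (6.1)**: the covariant one-step block average (2.6) of the unit-lattice scalar field `φ`, transporting with the actual background
`u_k(u)` along the `η`-bonds of the contours `Γ_{yx}` ((2.5); unit-bond field `ū_k = lineIter u_k k`, [BalabanImbrieJaffe1988] (4.4)) — r18's `qCov`
at p11's `lineIter (u_k u) k`. [cite: BalabanImbrieJaffe1985, (6.1) p.318] -/
def qH (u : GaugeField P (0 + s.k) U1) (φ : HiggsField P (0 + s.k)) : HiggsField P (0 + s.k + 1) :=
  qCov (lineIter (s.uk u) s.k) φ

/-- kernel: **(2.6) for `Q(u_k)`** — `(Q(u_k)φ)(y) = L^{−d}Σ_{x∈B(y)} u_k(Γ_{yx})φ(x)`, the transport `u_k(Γ_{yx}) = Π u_k` over the `η`-bonds of `Γ_{yx}`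
(r18's `holC` of the unit-bond products `lineIter u_k k`). [cite: BalabanImbrieJaffe1985, (2.6) p.303] -/
theorem qH_apply (u : GaugeField P (0 + s.k) U1) (φ : HiggsField P (0 + s.k)) (y : TSite P (0 + s.k + 1)) :
    s.qH u φ y = ((P.L : ℂ) ^ P.d)⁻¹ * ∑ x ∈ block y, holC (lineIter (s.uk u) s.k) x * φ x :=
  qCov_apply _ _ y

/-- kernel: **`Q(u_k) ∘ Q_k(u_k) = Q_{k+1}(u_k)`** — the `Q(u_k)` of (6.1) is the top factor of p11's `k+1`-level average `qCovK u_k (k+1)` (the composition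
along (5.1.3) that Sect. 6.3 uses). [cite: BalabanImbrieJaffe1985, (6.1) p.318] -/
theorem qH_qCovK (u : GaugeField P (0 + s.k) U1) (χ : HiggsField P 0) :
    s.qH u (qCovK (s.uk u) s.k χ) = qCovK (s.uk u) (s.k + 1) χ :=
  (qCovK_succ _ _ _).symm

/-- **`S_k(u, φ)` of (6.1) = THE MEAN FIELD ACTION (4.1) OF RECORD** `½⟨f^{(k)}, σ_kf^{(k)}⟩ + ½⟨φ, Δ_k(u_k)φ⟩` — r15's `BIJ85MeanFieldAction41.meanFieldAction`
at the index `s.idx u` (this torus, scale `k`, coupling `e_k`, `v := u`) and the scalar field `φ` (print: *"In (4.1) we ignore the small corrections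
due to interactions"*). [cite: BalabanImbrieJaffe1985, (6.1) p.318] -/
def Sk (a : ℝ) (ha : 0 < a) (u : GaugeField P (0 + s.k) U1) (φ : HiggsField P (0 + s.k)) : ℝ :=
  meanFieldAction a ha (s.idx u) (WithLp.toLp 2 φ : CoarseSpK P 0 s.k)

/-- kernel (lead's check (ii)): `S_k` IS `meanFieldAction`, by `rfl`. [cite: BalabanImbrieJaffe1985, (4.1) p.309] -/
theorem Sk_eq (a : ℝ) (ha : 0 < a) (u : GaugeField P (0 + s.k) U1) (φ : HiggsField P (0 + s.k)) :
    s.Sk a ha u φ = meanFieldAction a ha (s.idx u) (WithLp.toLp 2 φ : CoarseSpK P 0 s.k) := rfl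

/-- `S_k(v, ψ)` of (4.1) on non-dependent carriers: the mean field action at the index `idxV v` and `ψ ∈ ℓ²(T₁^{(k)})` (so that equalities of the
field slot can be rewritten under it). [cite: BalabanImbrieJaffe1985, (4.1) p.309] -/
def SkV (a : ℝ) (ha : 0 < a) (v : U1Field P s.k) (ψ : CoarseSpK P 0 s.k) : ℝ := meanFieldAction a ha (s.idxV v) ψ

/-- kernel: `S_k(u, φ) = S_k(v, ψ)` at `v := vOf k u`, `ψ := φ`, by `rfl`. [cite: BalabanImbrieJaffe1985, (6.1) p.318] -/
theorem Sk_eq_SkV (a : ℝ) (ha : 0 < a) (u : GaugeField P (0 + s.k) U1) (φ : HiggsField P (0 + s.k)) :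
    s.Sk a ha u φ = s.SkV a ha (vOf s.k u) (WithLp.toLp 2 φ) := rfl

/-- **`e^{−S_k(u, φ)}`**, the density of (6.1) to which the transformation is applied (the `ρ₀` slot of r18's `IsRT311`).
[cite: BalabanImbrieJaffe1985, (6.1) p.318] -/
def rho (a : ℝ) (ha : 0 < a) (u : GaugeField P (0 + s.k) U1) (φ : HiggsField P (0 + s.k)) : ℂ :=
  ((Real.exp (-s.Sk a ha u φ) : ℝ) : ℂ)

/-- kernel: the gauge-field part of `S_k(u, ·)` is `½⟨f^{(k)}, σ_kf^{(k)}⟩` with `f^{(k)} = (ie_k)^{−1}ln u(∂·)` of THIS `u` ((4.2.4)/(6.3); by `rfl`).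
[cite: BalabanImbrieJaffe1985, (4.2.5) p.310] -/
theorem gaugePart_idx (u : GaugeField P (0 + s.k) U1) :
    gaugePart (s.idx u) = (1 / 2 : ℝ) * ⟪toU P s.k (plaqField s.e (vOf s.k u)),
      sigmaTorus (P := P) s.hd2 (P.eta s.k ^ P.d) ((P.L : ℝ) ^ s.k) s.k (toU P s.k (plaqField s.e (vOf s.k u)))⟫ := rfl

/-- kernel: the scalar part of `S_k(u, ·)` is `½⟨φ, Δ_k(u_k(u))φ⟩` with p33's Sect. 7.3 datum (printed `a_k`, THE inverse (4.6.2) `allG`; by `rfl`).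
[cite: BalabanImbrieJaffe1985, (4.6.4) p.313] -/
theorem scalarPart_idx (a : ℝ) (ha : 0 < a) (u : GaugeField P (0 + s.k) U1) (ψ : CoarseSpK P 0 s.k) :
    scalarPart a ha (s.idx u) ψ = (1 / 2 : ℝ) * ⟪ψ, deltaOp (QlinK (s.uk u) s.k) (aK a P.L s.k) (s.Gk a ha u) ψ⟫ := rfl

/-- The form (3.25)/(4.6.1) `½a_k‖Q_k(U)χ − ψ‖² + ½‖D_Uχ‖²` at the step's constants (p11's carriers; its minimum over `χ` is `½⟨ψ, Δ_k(U)ψ⟩`).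
[cite: BalabanImbrieJaffe1985, (4.6.1) p.313] -/
def sForm (a : ℝ) (U : GaugeField P 0 U1) (ψ : CoarseSpK P 0 s.k) (χ : FineSp P 0) : ℝ :=
  scalarForm (Dlin (cPhys P s.k) U) (QlinK U s.k) (aK a P.L s.k) ψ χ

/-- kernel: `sForm` as the printed sums `½a_kΣ_y|(Q_k(U)χ)(y) − ψ(y)|² + ½Σ_b|c(U_bχ(b₊) − χ(b₋))|²` (p11's `scalarForm_torusK`).
[cite: BalabanImbrieJaffe1985, (4.6.1) p.313] -/
theorem sForm_eq (a : ℝ) (U : GaugeField P 0 U1) (ψ : CoarseSpK P 0 s.k) (χ : FineSp P 0) :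
    s.sForm a U ψ χ = (1 / 2 : ℝ) * aK a P.L s.k * (∑ y : TSite P (0 + s.k), ‖qCovK U s.k (WithLp.ofLp χ) y - ψ y‖ ^ 2)
      + (1 / 2 : ℝ) * ∑ b : PBond P 0, ‖(cPhys P s.k : ℂ) * (toC (U b) * χ b.tgt - χ b.src)‖ ^ 2 :=
  scalarForm_torusK _ _ U s.k ψ χ

/-- kernel: `sForm ≥ 0` (`a ≥ 0`). [cite: BalabanImbrieJaffe1985, (4.6.1) p.313] -/
theorem sForm_nonneg {a : ℝ} (ha : 0 ≤ aK a P.L s.k) (U : GaugeField P 0 U1) (ψ : CoarseSpK P 0 s.k) (χ : FineSp P 0) :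
    0 ≤ s.sForm a U ψ χ := by
  unfold sForm scalarForm
  exact add_nonneg (mul_nonneg (mul_nonneg (by norm_num) ha) (sq_nonneg _)) (mul_nonneg (by norm_num) (sq_nonneg _))

/-- kernel: the printed `a_k > 0` at the step. [cite: BalabanImbrieJaffe1985, (4.6.4) p.313] -/
theorem aK_pos {a : ℝ} (ha : 0 < a) (u : GaugeField P (0 + s.k) U1) : 0 < aK a P.L s.k := (s.idx u).aK_pos ha

/-- **`½⟨ψ, Δ_k(u_k)ψ⟩` IS THE MINIMUM OF THE FORM (4.6.1) over the `η`-lattice field** (p. 313 *"The scalar field action depends on the unit lattice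
field ψ through the η-lattice minimizer ψ_k"*; p11/p30's `scalarForm_phiCl` + `isMinOn_phiCl` at THE inverse `allG`) — so the scalar part of `S_k`
does not depend on the choice of the right inverse `G_k(u_k)`. [cite: BalabanImbrieJaffe1985, (4.6.4) p.313] -/
theorem scalarPart_idx_eq_iInf (a : ℝ) (ha : 0 < a) (u : GaugeField P (0 + s.k) U1) (ψ : CoarseSpK P 0 s.k) :
    scalarPart a ha (s.idx u) ψ = ⨅ χ : FineSp P 0, s.sForm a (s.uk u) ψ χ := by
  have hG : ∀ φ, opT (Dlin (cPhys P s.k) (s.uk u)) (QlinK (s.uk u) s.k) (aK a P.L s.k) (s.Gk a ha u φ) = φ :=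
    s.Gk_spec a ha u
  have hmin := isMinOn_phiCl hG (s.aK_pos ha u).le ψ
  have hval := scalarForm_phiCl hG ψ
  rw [scalarPart_idx, ← hval]
  symm
  refine IsLeast.csInf_eq ⟨⟨phiCl (QlinK (s.uk u) s.k) (aK a P.L s.k) (s.Gk a ha u) ψ, rfl⟩, ?_⟩
  rintro _ ⟨χ, rfl⟩
  exact (isMinOn_univ_iff.mp hmin) χ

/-- kernel: `S_k(u, φ) ≥ 0` (Theorem 7.1.1 for the gauge part, r15's `gaugePart_nonneg`; the scalar part is a minimum of non-negative forms).
[cite: BalabanImbrieJaffe1985, (4.1) p.309] -/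
theorem Sk_nonneg (a : ℝ) (ha : 0 < a) (u : GaugeField P (0 + s.k) U1) (φ : HiggsField P (0 + s.k)) : 0 ≤ s.Sk a ha u φ := by
  have h1 := gaugePart_nonneg (s.idx u)
  have h2 : 0 ≤ scalarPart a ha (s.idx u) (WithLp.toLp 2 φ : CoarseSpK P 0 s.k) := by
    rw [scalarPart_idx_eq_iInf]
    exact le_ciInf fun χ => s.sForm_nonneg (s.aK_pos ha u).le _ _ χ
  exact add_nonneg h1 h2

/-- kernel: `|e^{−S_k(u, φ)}| = e^{−S_k(u, φ)}`. [cite: BalabanImbrieJaffe1985, (6.1) p.318] -/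
theorem norm_rho (a : ℝ) (ha : 0 < a) (u : GaugeField P (0 + s.k) U1) (φ : HiggsField P (0 + s.k)) :
    ‖s.rho a ha u φ‖ = Real.exp (-s.Sk a ha u φ) := by
  rw [rho, Complex.norm_real, Real.norm_eq_abs, abs_of_pos (Real.exp_pos _)]

/-- kernel: `0 < e^{−S_k} ≤ 1` — the density of (6.1) is BOUNDED; its `𝒟u𝒟φ`-integrability is a question at `φ → ∞` only (HONEST SCOPE).
[cite: BalabanImbrieJaffe1985, (6.1) p.318] -/
theorem norm_rho_le_one (a : ℝ) (ha : 0 < a) (u : GaugeField P (0 + s.k) U1) (φ : HiggsField P (0 + s.k)) :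
    ‖s.rho a ha u φ‖ ≤ 1 := by
  rw [norm_rho, Real.exp_le_one_iff, neg_nonpos]
  exact s.Sk_nonneg a ha u φ

/-- THE INTEGRAND OF (6.1) after the `δ`-functions: `e^{−S_k(u, φ)} · δ_H(ψ − Q(u_k)φ)` (r18's normalized `gaussWeight a` for `δ_H`).
[cite: BalabanImbrieJaffe1985, (6.1) p.318] -/
def integrand61 (a : ℝ) (ha : 0 < a) (u : GaugeField P (0 + s.k) U1) (φ : HiggsField P (0 + s.k)) (ψ : HiggsField P (0 + s.k + 1)) : ℂ :=
  s.rho a ha u φ * (gaussWeight a (s.qH u φ) ψ : ℂ)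

/-! ## §3  Measurability of the integrand of (6.1) in `(u, φ)` -/

/-- kernel: reading a `U(1)` configuration in `ℂ` is measurable. [folklore] -/
private theorem measurable_cfg {j : ℕ} : Measurable (cfg : GaugeField P j U1 → PBond P j → ℂ) :=
  measurable_pi_lambda _ fun b => measurable_toC.comp (measurable_pi_apply b)

/-- kernel: a plaquette variable is a continuous function of the ℂ-valued bond field. [folklore] -/
private theorem continuous_plaqVar {j : ℕ} (p : TPlaq P j) : Continuous fun u : PBond P j → ℂ => plaqVar u p := by
  unfold plaqVar
  fun_prop

/-- **`u ↦ f^{(k)} = (ie_k)^{−1}ln u(∂·)` is measurable** (the branch (2.11) is a measurable discontinuity: r18's `measurable_argB`).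
[cite: BalabanImbrieJaffe1985, (6.3) p.318] -/
theorem measurable_plaqField_vOf (k : ℕ) (e : ℝ) : Measurable fun u : GaugeField P (0 + k) U1 => plaqField e (vOf k u) := by
  refine measurable_pi_lambda _ fun p => ?_
  have h : (fun u : GaugeField P (0 + k) U1 => plaqField e (vOf k u) p) =
      fun u => BIJ85Sect1Model.argB (plaqVar (cfg (lvl (Nat.zero_add k) u)) p) / e := by
    funext u
    rw [plaqField, coe_plaq_vOf]
  rw [h]
  exact (measurable_argB.comp ((continuous_plaqVar p).measurable.comp (measurable_cfg.comp (measurable_lvl _)))).div_const e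

/-- kernel: the one-step pull-back `Q^{s*}` (4.5.3) is measurable (each bond variable is `1` or a coordinate). [cite: BalabanImbrieJaffe1985, (4.5.3) p.312] -/
theorem measurable_qsstarG {G : Type*} [One G] [MeasurableSpace G] {j : ℕ} :
    Measurable (qsstarG : GaugeField P (j + 1) G → GaugeField P j G) := by
  refine measurable_pi_lambda _ fun b => ?_
  by_cases h : blockOf b.tgt = blockOf b.src
  · simp only [qsstarG_apply, if_pos h]; exact measurable_const
  · simp only [qsstarG_apply, if_neg h]; exact measurable_pi_apply _

/-- kernel: the `k`-fold pull-back `Q^{s*}_k` (4.5.3) is measurable. [cite: BalabanImbrieJaffe1985, (4.5.3) p.312] -/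
theorem measurable_qsstarGIter {G : Type*} [One G] [MeasurableSpace G] {i : ℕ} :
    ∀ k : ℕ, Measurable (qsstarGIter (P := P) (G := G) (i := i) k)
  | 0 => measurable_id
  | k + 1 => (measurable_qsstarGIter k).comp measurable_qsstarG

/-- kernel: the ordered products (2.5) along a straight run are measurable functions of the field. [cite: BalabanImbrieJaffe1985, (2.5) p.302] -/
theorem measurable_runProd {j : ℕ} (x : TSite P j) (μ : Fin P.d) :
    ∀ n : ℕ, Measurable fun U : GaugeField P j U1 => runProd U x μ n
  | 0 => measurable_const
  | n + 1 => (measurable_runProd x μ n).mul (measurable_pi_apply _)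

/-- kernel: `u ↦ u(Γ_{yy′})` (p11's `lineU`) is measurable. [cite: BalabanImbrieJaffe1985, (2.5) p.302] -/
theorem measurable_lineU {j : ℕ} : Measurable (lineU : GaugeField P j U1 → GaugeField P (j + 1) U1) :=
  measurable_pi_lambda _ fun _ => measurable_runProd _ _ _

/-- kernel: the iterates `u ↦ u^{(k)}` (p11's `lineIter`) are measurable. [cite: BalabanImbrieJaffe1985, (5.1.3) p.314] -/
theorem measurable_lineIter {j : ℕ} : ∀ k : ℕ, Measurable fun U : GaugeField P j U1 => lineIter U k
  | 0 => measurable_id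
  | k + 1 => measurable_lineU.comp (measurable_lineIter k)

/-- kernel: the composite transports `u(Γ^{(k)}_{yx})` (p11's `holCK`) are measurable functions of the field. [cite: BalabanImbrieJaffe1985, (5.1.3) p.314] -/
theorem measurable_holCK {j : ℕ} : ∀ (k : ℕ) (x : TSite P j), Measurable fun U : GaugeField P j U1 => holCK U k x
  | 0, x => by simp only [holCK_zero]; exact measurable_const
  | k + 1, x => by
    simp only [holCK_succ]
    exact ((measurable_holC _).comp (measurable_lineIter k)).mul (measurable_holCK k x)

/-- kernel: `u ↦ (Q_k(u)φ)(y)` is measurable for a fixed scalar field (p11's formula `qCovK_apply`). [cite: BalabanImbrieJaffe1985, (4.6.1) p.313] -/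
theorem measurable_qCovK_apply {j : ℕ} (k : ℕ) (φ : HiggsField P j) (y : TSite P (j + k)) :
    Measurable fun U : GaugeField P j U1 => qCovK U k φ y := by
  have h : (fun U : GaugeField P j U1 => qCovK U k φ y) =
      fun U => ((P.L : ℂ) ^ (k * P.d))⁻¹ * ∑ x ∈ BIJ85BlockAveragesTorusK.blockK k y, holCK U k x * φ x :=
    funext fun U => qCovK_apply U φ k y
  rw [h]
  exact (Finset.measurable_sum _ fun x _ => (measurable_holCK k x).mul_const _).const_mul _

/-- **`u ↦ u_k(u)` IS MEASURABLE** — through the closed form `uk_eq`: the pull-back, the linear operator `T_k` (continuous: finite dimension), the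
measurable `f^{(k)}`, r18's `expU1`. [cite: BalabanImbrieJaffe1985, (4.5.4) p.313] -/
theorem measurable_uk : Measurable s.uk := by
  have h : s.uk = fun u b => qsstarGIter s.k u b *
      phase (fun b => (s.e * P.eta s.k) * -TkF P s.hd2 ((P.eta s.k) ^ P.d) (P.eta s.k) s.k (plaqField s.e (vOf s.k u)) b) b :=
    funext s.uk_eq
  rw [h]
  refine measurable_pi_lambda _ fun b => ?_
  refine ((measurable_pi_apply b).comp (measurable_qsstarGIter s.k)).mul ?_
  show Measurable fun u : GaugeField P (0 + s.k) U1 =>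
    expU1 ((s.e * P.eta s.k) * -TkF P s.hd2 ((P.eta s.k) ^ P.d) (P.eta s.k) s.k (plaqField s.e (vOf s.k u)) b)
  have hT : Measurable (TkF P s.hd2 ((P.eta s.k) ^ P.d) (P.eta s.k) s.k : (TPlaq P s.k → ℝ) → (PBond P 0 → ℝ)) :=
    (LinearMap.continuous_of_finiteDimensional _).measurable
  exact measurable_expU1.comp
    (((measurable_pi_apply b).comp (hT.comp (measurable_plaqField_vOf s.k s.e))).neg.const_mul _)

/-- **`(u, φ) ↦ Q(u_k)φ` IS JOINTLY MEASURABLE** (r18's `measurable_qCov` ∘ `lineIter` ∘ `uk`). [cite: BalabanImbrieJaffe1985, (6.1) p.318] -/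
theorem measurable_qH : Measurable (uncurry s.qH) := by
  have hf : Measurable fun p : GaugeField P (0 + s.k) U1 × HiggsField P (0 + s.k) => (lineIter (s.uk p.1) s.k, p.2) :=
    (((measurable_lineIter s.k).comp s.measurable_uk).comp measurable_fst).prodMk measurable_snd
  have h : uncurry s.qH = uncurry qCov ∘ fun p : GaugeField P (0 + s.k) U1 × HiggsField P (0 + s.k) => (lineIter (s.uk p.1) s.k, p.2) := by
    funext p
    rfl
  rw [h]
  exact measurable_qCov.comp hf

/-- kernel: the gauge-field part `u ↦ ½⟨f^{(k)}, σ_kf^{(k)}⟩` is measurable (`σ_k` continuous: finite dimension; `f^{(k)}` measurable).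
[cite: BalabanImbrieJaffe1985, (4.2.5) p.310] -/
theorem measurable_gaugePart_idx : Measurable fun u : GaugeField P (0 + s.k) U1 => gaugePart (s.idx u) := by
  have hσ : Continuous (sigmaTorus (P := P) s.hd2 (P.eta s.k ^ P.d) ((P.L : ℝ) ^ s.k) s.k) :=
    LinearMap.continuous_of_finiteDimensional _
  have hT : Continuous (toU P s.k) := LinearMap.continuous_of_finiteDimensional (toU P s.k).toLinearMap
  have hG : Continuous fun g : TPlaq P s.k → ℝ => (1 / 2 : ℝ) * ⟪toU P s.k g,
      sigmaTorus (P := P) s.hd2 (P.eta s.k ^ P.d) ((P.L : ℝ) ^ s.k) s.k (toU P s.k g)⟫ :=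
    (hT.inner (hσ.comp hT)).const_mul _
  have h : (fun u : GaugeField P (0 + s.k) U1 => gaugePart (s.idx u)) = fun u => (1 / 2 : ℝ) * ⟪toU P s.k (plaqField s.e (vOf s.k u)),
      sigmaTorus (P := P) s.hd2 (P.eta s.k ^ P.d) ((P.L : ℝ) ^ s.k) s.k (toU P s.k (plaqField s.e (vOf s.k u)))⟫ :=
    funext s.gaugePart_idx
  rw [h]
  exact (hG.measurable.comp (measurable_plaqField_vOf s.k s.e) :)

/-- kernel: for a FIXED `η`-lattice field `χ`, `(U, ψ) ↦ sForm U ψ χ` is jointly measurable (finite sums of bond and block terms).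
[cite: BalabanImbrieJaffe1985, (4.6.1) p.313] -/
theorem measurable_sForm_fixed (a : ℝ) (χ : FineSp P 0) :
    Measurable fun q : GaugeField P 0 U1 × CoarseSpK P 0 s.k => s.sForm a q.1 q.2 χ := by
  have h : (fun q : GaugeField P 0 U1 × CoarseSpK P 0 s.k => s.sForm a q.1 q.2 χ) = fun q =>
      (1 / 2 : ℝ) * aK a P.L s.k * (∑ y : TSite P (0 + s.k), ‖qCovK q.1 s.k (WithLp.ofLp χ) y - q.2 y‖ ^ 2)
        + (1 / 2 : ℝ) * ∑ b : PBond P 0, ‖(cPhys P s.k : ℂ) * (toC (q.1 b) * χ b.tgt - χ b.src)‖ ^ 2 :=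
    funext fun q => s.sForm_eq a q.1 q.2 χ
  rw [h]
  refine ((Finset.measurable_sum _ fun y _ => ?_).const_mul _).add ((Finset.measurable_sum _ fun b _ => ?_).const_mul _)
  · exact (((measurable_qCovK_apply s.k _ y).comp measurable_fst).sub
      ((measurable_pi_apply y).comp ((WithLp.measurable_ofLp 2 _).comp measurable_snd))).norm.pow_const 2
  · exact (((((measurable_toC_apply b).comp measurable_fst).mul_const _).sub_const _).const_mul _).norm.pow_const 2

/-- kernel: for fixed `(U, ψ)`, `χ ↦ sForm U ψ χ` is continuous (`Q_k(U)`, `D_U` linear on finite-dimensional spaces). [cite: BalabanImbrieJaffe1985, (4.6.1) p.313] -/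
theorem continuous_sForm (a : ℝ) (U : GaugeField P 0 U1) (ψ : CoarseSpK P 0 s.k) : Continuous fun χ : FineSp P 0 => s.sForm a U ψ χ := by
  have hQ : Continuous (QlinK U s.k) := LinearMap.continuous_of_finiteDimensional _
  have hD : Continuous (Dlin (cPhys P s.k) U) := LinearMap.continuous_of_finiteDimensional _
  unfold sForm scalarForm
  exact (((hQ.sub continuous_const).norm.pow 2).const_mul _).add ((hD.norm.pow 2).const_mul _)

/-- kernel: the infimum of a continuous function bounded below equals its infimum along a dense sequence. [folklore] -/
private theorem iInf_eq_iInf_denseSeq {α : Type*} [TopologicalSpace α] {f : α → ℝ} (hf : Continuous f)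
    (hbdd : BddBelow (Set.range f)) {d : ℕ → α} (hd : DenseRange d) : ⨅ x, f x = ⨅ n, f (d n) := by
  haveI : Nonempty α := ⟨d 0⟩
  have hbdd' : BddBelow (Set.range fun n => f (d n)) :=
    hbdd.mono (by rintro _ ⟨n, rfl⟩; exact ⟨d n, rfl⟩)
  refine le_antisymm (le_ciInf fun n => ciInf_le hbdd (d n)) (le_ciInf fun x => ?_)
  refine le_of_forall_pos_le_add fun ε hε => ?_
  have hopen : IsOpen (f ⁻¹' Set.Iio (f x + ε)) := hf.isOpen_preimage _ isOpen_Iio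
  obtain ⟨n, hn⟩ := hd.exists_mem_open hopen ⟨x, by simpa using hε⟩
  exact (ciInf_le hbdd' n).trans (le_of_lt hn)

/-- **`(u, φ) ↦ ½⟨φ, Δ_k(u_k(u))φ⟩` IS JOINTLY MEASURABLE** — the minimum `scalarPart_idx_eq_iInf` taken along a dense sequence of the (separable,
finite-dimensional) `η`-lattice field space: a countable infimum of jointly measurable functions. [cite: BalabanImbrieJaffe1985, (4.6.4) p.313] -/
theorem measurable_scalarPart_idx (a : ℝ) (ha : 0 < a) :
    Measurable fun p : GaugeField P (0 + s.k) U1 × HiggsField P (0 + s.k) =>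
      scalarPart a ha (s.idx p.1) (WithLp.toLp 2 p.2 : CoarseSpK P 0 s.k) := by
  obtain ⟨d, hd⟩ := TopologicalSpace.exists_dense_seq (FineSp P 0)
  have h : (fun p : GaugeField P (0 + s.k) U1 × HiggsField P (0 + s.k) =>
      scalarPart a ha (s.idx p.1) (WithLp.toLp 2 p.2 : CoarseSpK P 0 s.k)) =
      fun p => ⨅ n, s.sForm a (s.uk p.1) (WithLp.toLp 2 p.2) (d n) := by
    funext p
    rw [scalarPart_idx_eq_iInf]
    exact iInf_eq_iInf_denseSeq (s.continuous_sForm a _ _)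
      ⟨0, by rintro _ ⟨χ, rfl⟩; exact s.sForm_nonneg (s.aK_pos ha p.1).le _ _ χ⟩ hd
  rw [h]
  refine Measurable.iInf fun n => ?_
  have h2 : Measurable fun p : GaugeField P (0 + s.k) U1 × HiggsField P (0 + s.k) => (s.uk p.1, (WithLp.toLp 2 p.2 : CoarseSpK P 0 s.k)) :=
    ((s.measurable_uk.comp measurable_fst).prodMk ((WithLp.measurable_toLp 2 (HiggsField P (0 + s.k))).comp measurable_snd) :)
  exact ((s.measurable_sForm_fixed a (d n)).comp h2 :)

/-- **`(u, φ) ↦ S_k(u, φ)` IS JOINTLY MEASURABLE.** [cite: BalabanImbrieJaffe1985, (6.1) p.318] -/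
theorem measurable_Sk (a : ℝ) (ha : 0 < a) : Measurable (uncurry (s.Sk a ha)) := by
  have h : uncurry (s.Sk a ha) = fun p => gaugePart (s.idx p.1) + scalarPart a ha (s.idx p.1) (WithLp.toLp 2 p.2 : CoarseSpK P 0 s.k) := rfl
  rw [h]
  exact ((s.measurable_gaugePart_idx.comp measurable_fst).add (s.measurable_scalarPart_idx a ha) :)

/-- **the density `e^{−S_k}` of (6.1) is jointly measurable** (first of the three obligations of the existence route). [cite: BalabanImbrieJaffe1985, (6.1) p.318] -/
theorem measurable_rho (a : ℝ) (ha : 0 < a) : Measurable (uncurry (s.rho a ha)) := by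
  have h : uncurry (s.rho a ha) = fun p => ((Real.exp (-uncurry (s.Sk a ha) p) : ℝ) : ℂ) := rfl
  rw [h]
  exact (Complex.measurable_ofReal.comp (Real.measurable_exp.comp (s.measurable_Sk a ha).neg) :)

/-! ## §4  Joint gauge invariance of the integrand of (6.1) -/

/-- kernel: **the index of `u^g` is the gauge transform (2.7) of the index of `u`** (r13's `gaugeIdx`; the dictionary `vOf_gaugeAct`).
[cite: BalabanImbrieJaffe1985, (2.7) p.303] -/
theorem idx_gaugeAct (g : GaugeTransf P (0 + s.k) U1) (u : GaugeField P (0 + s.k) U1) :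
    s.idx (gaugeAct g u) = gaugeIdx (s.idx u) (gcOf s.k g) := by
  show s.idxV (vOf s.k (gaugeAct g u)) = s.idxV (gaugeU (gcOf s.k g) (vOf s.k u))
  rw [vOf_gaugeAct]

/-- kernel: **(6.3.2) on the non-dependent carriers** — `S_k(v^g, gψ) = S_k(v, ψ)` (r13's `meanFieldAction_gaugeIdx` at `idxV v`, `gaugeIdx_idxV`).
[cite: BalabanImbrieJaffe1985, (6.3.2) p.320] -/
theorem SkV_gaugeU (a : ℝ) (ha : 0 < a) (v : U1Field P s.k) (g : TSite P s.k → Circle) {ψ ψ' : CoarseSpK P 0 s.k}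
    (hψ' : ∀ y, ψ' y = (g (siteK s.k y) : ℂ) * ψ y) : s.SkV a ha (gaugeU g v) ψ' = s.SkV a ha v ψ :=
  meanFieldAction_gaugeIdx a ha (s.idxV v) g hψ'

/-- **(6.3.2) FOR THE `S_k` OF (6.1)**: `S_k(u^g, gφ) = S_k(u, φ)` for every `U(1)` gauge transformation `g` of the unit lattice — r13's
`meanFieldAction_gaugeIdx` ((ν) of the row owner's list) BY NAME. [cite: BalabanImbrieJaffe1985, (6.3.2) p.320] -/
theorem Sk_gaugeAct (a : ℝ) (ha : 0 < a) (g : GaugeTransf P (0 + s.k) U1) (u : GaugeField P (0 + s.k) U1) (φ : HiggsField P (0 + s.k)) :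
    s.Sk a ha (gaugeAct g u) (twist g φ) = s.Sk a ha u φ := by
  rw [Sk_eq_SkV, Sk_eq_SkV, vOf_gaugeAct]
  refine s.SkV_gaugeU a ha (vOf s.k u) (gcOf s.k g) fun y => ?_
  show toC (g y) * φ y = ((circleEquivU1.symm (g (siteK' s.k (siteK s.k y))) : Circle) : ℂ) * φ y
  rw [coe_circleEquivU1_symm, siteK'_siteK]

/-- **`e^{−S_k}` IS JOINTLY GAUGE INVARIANT** (`BIJ85RT33.JointInvariant`; second obligation of the existence route).
[cite: BalabanImbrieJaffe1985, (6.3.2) p.320] -/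
theorem jointInvariant_rho (a : ℝ) (ha : 0 < a) : JointInvariant (s.rho a ha) := fun g u φ => by
  show ((Real.exp (-s.Sk a ha (gaugeAct g u) (twist g φ)) : ℝ) : ℂ) = ((Real.exp (-s.Sk a ha u φ) : ℝ) : ℂ)
  rw [Sk_gaugeAct]

/-- **`u_k(u^g) = (u_k(u))^{g∘B^k}`** — the actual background of the transformed variable is the gauge transform by the block-constant `η`-lattice
transformation (r13's `actualBgU1_gaugeU` through `vOf_gaugeAct`). [cite: BalabanImbrieJaffe1985, (6.3.2) p.320] -/
theorem uk_gaugeAct (g : GaugeTransf P (0 + s.k) U1) (u : GaugeField P (0 + s.k) U1) :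
    s.uk (gaugeAct g u) = gaugeAct (fun x => g (blockOfIter s.k x)) (s.uk u) := by
  unfold uk
  rw [vOf_gaugeAct, actualBgU1_gaugeU s.hd2 s.hk0, transfK_gcOf]

/-- **(2.8) FOR `Q(u_k)`**: `Q(u_k(u^g))(gφ) = (g∘corner)·Q(u_k(u))φ` — the block-constant transformation of `u_k` read along the unit bonds is `g`
at the corners (p11's `lineIter_gaugeAct`, `blkIter_cornerIter`), then r18's (2.8) `qCov_gaugeAct_twist`. [cite: BalabanImbrieJaffe1985, (2.8) p.303] -/
theorem qH_gaugeAct (g : GaugeTransf P (0 + s.k) U1) (u : GaugeField P (0 + s.k) U1) (φ : HiggsField P (0 + s.k)) :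
    s.qH (gaugeAct g u) (twist g φ) = twist (fun y => g (corner y)) (s.qH u φ) := by
  have hline : lineIter (s.uk (gaugeAct g u)) s.k = gaugeAct g (lineIter (s.uk u) s.k) := by
    rw [uk_gaugeAct, lineIter_gaugeAct _ _ s.k s.hk0]
    congr 1
    funext y
    have h := transfK_blockOfIter_cornerIter s.hk0 (gcOf s.k g) y
    rwa [transfK_gcOf] at h
  funext y
  show qCov (lineIter (s.uk (gaugeAct g u)) s.k) (twist g φ) y = toC (g (corner y)) * qCov (lineIter (s.uk u) s.k) φ y
  rw [hline, qCov_gaugeAct_twist s.hj]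

/-- kernel: the normalized Gaussian `δ_H` is invariant under the simultaneous rotation of centre and variable by unit phases at the `L`-lattice sites.
[cite: BalabanImbrieJaffe1985, (3.6) p.306] -/
theorem gaussWeight_twist {j : ℕ} (a : ℝ) (h : GaugeTransf P (j + 1) U1) (c ψ : HiggsField P (j + 1)) :
    gaussWeight a (twist h c) (twist h ψ) = gaussWeight a c ψ := by
  unfold gaussWeight
  congr 3
  refine Finset.sum_congr rfl fun y _ => ?_
  rw [twist_apply, twist_apply, ← mul_sub, norm_mul, BIJ88Sect3Statements.norm_toC, one_mul]

/-- **THE INTEGRAND OF (6.1) IS JOINTLY GAUGE INVARIANT** under `(u, φ, ψ) ↦ (u^g, gφ, (g∘corner)ψ)` — p. 306: *"They generate the gauge group of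
the integral 𝒯(exp −S)"* — at the `k`-th step, for the mean-field `S_k` and print's `Q(u_k)`. [cite: BalabanImbrieJaffe1985, (3.3) p.306] -/
theorem integrand61_gaugeAct (a : ℝ) (ha : 0 < a) (g : GaugeTransf P (0 + s.k) U1) (u : GaugeField P (0 + s.k) U1)
    (φ : HiggsField P (0 + s.k)) (ψ : HiggsField P (0 + s.k + 1)) :
    s.integrand61 a ha (gaugeAct g u) (twist g φ) (twist (fun y => g (corner y)) ψ) = s.integrand61 a ha u φ ψ := by
  unfold integrand61
  rw [s.jointInvariant_rho a ha g u φ, qH_gaugeAct, gaussWeight_twist]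

/-! ## §5  (6.1) typed and inhabited: r18's `IsRT311` at print's integrand -/

/-- kernel: **p34's existence theorem at the data of (6.1)** — for ANY jointly measurable density `ρ(u, φ)` on the `k`-th step fields that is
`𝒟u𝒟φ`-integrable IN THE AXIAL GAUGE (`u ↦ u[axialBonds := 1]`, r18's forest (3.4)), the Radon–Nikodym transform `ρ₁ := 𝒯ρ` of (3.3) (p34's
`RTData.rt` over `axialRTData` with `Qu` = r18's (2.10) `qU`, Haar-regular by r18's `absolutelyContinuous_map_qU`, and `Q(·)φ` = `Q(u_k)φ` = `s.qH`)
satisfies `IsRT311 qU (Q(u_k)·) a ρ ρ₁` and is `dv dψ`-integrable (p34's `isRT311_rt_of_integrable_ax`, `integrable_rt_of_integrable_ax`).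
[cite: BalabanImbrieJaffe1985, (3.3) p.306] -/
theorem exists_isRT311_of_integrable_ax [DecidableEq (PBond P (0 + s.k))] {a : ℝ} (ha : 0 < a)
    {ρ : GaugeField P (0 + s.k) U1 → HiggsField P (0 + s.k) → ℂ} (hρm : Measurable (uncurry ρ))
    (hρa : Integrable (uncurry fun U φ => ρ (fixBonds axialBonds U) φ) ((fieldMeasure P (0 + s.k) U1).prod volume)) :
    ∃ ρ₁ : GaugeField P (0 + s.k + 1) U1 → HiggsField P (0 + s.k + 1) → ℂ,
      IsRT311 qU s.qH a ρ ρ₁ ∧ Integrable (uncurry ρ₁) ((fieldMeasure P (0 + s.k + 1) U1).prod volume) := by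
  let D := axialRTData s.hj qU measurable_qU s.qH s.measurable_qH (absolutelyContinuous_map_qU s.hj)
  have hax : (fun U φ => ρ (D.ax U) φ) = fun U φ => ρ (fixBonds axialBonds U) φ := by
    funext U φ
    rw [ax_eq_fixBonds (D := D) rfl]
  have hρa' : Integrable (uncurry fun U φ => ρ (D.ax U) φ) ((fieldMeasure P (0 + s.k) U1).prod volume) := by
    rw [hax]; exact hρa
  exact ⟨_, isRT311_rt_of_integrable_ax ha s.hd2 D rfl hρm hρa',
    integrable_rt_of_integrable_ax (D := D) (A := gaussApprox ha s.hd2) hρm hρa'⟩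

/-- **(6.1)** p. 318 [PDF 20], verbatim: *"Thus we study ∫𝒟u𝒟φ δ(v/Qu)δ_{Ax}(u) exp[−½a‖ψ − Q(u_k)φ‖² − S_k(u, φ)]. (6.1)"* — TYPED as r18's
renormalization transformation `IsRT311` ([BalabanImbrieJaffe1988] (3.11) = (3.3) here, push-forward reading; `δ_{Ax}(u)` = its `axialMeasure`,
`δ(v/Qu)` with r18's (2.10) `qU`, the Gaussian = its normalized `gaussWeight a`) AT PRINT'S INTEGRAND — `Q(u_k)φ = s.qH`, `S_k = meanFieldAction`
(`s.rho = e^{−S_k}`) — and INHABITED: for `a > 0` and `e^{−S_k}` `𝒟u𝒟φ`-integrable IN THE AXIAL GAUGE there is a `dv dψ`-integrable density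
`ρ₁(v, ψ)` — the Radon–Nikodym transform `𝒯e^{−S_k}` of (3.3) — with `∫dv dψ ρ₁ g = ∫𝒟u δ_{Ax}(u)∫𝒟φ∫dψ e^{−S_k(u,φ)}δ_H(ψ − Q(u_k)φ) g(Qu, ψ)` for
every bounded measurable `g`.  The integrability `hI` is a HYPOTHESIS (HONEST SCOPE of the module docstring; hypothesis-free for the small-field
restricted density: `isRT311_eq61_smallField`). [cite: BalabanImbrieJaffe1985, (6.1) p.318] -/
theorem exists_isRT311_eq61_of_integrable_ax [DecidableEq (PBond P (0 + s.k))] (a : ℝ) (ha : 0 < a)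
    (hI : Integrable (uncurry fun U φ => s.rho a ha (fixBonds axialBonds U) φ) ((fieldMeasure P (0 + s.k) U1).prod volume)) :
    ∃ ρ₁ : GaugeField P (0 + s.k + 1) U1 → HiggsField P (0 + s.k + 1) → ℂ,
      IsRT311 qU s.qH a (s.rho a ha) ρ₁ ∧ Integrable (uncurry ρ₁) ((fieldMeasure P (0 + s.k + 1) U1).prod volume) :=
  s.exists_isRT311_of_integrable_ax ha (s.measurable_rho a ha) hI

/-- **(6.1) inhabited under plain `𝒟u𝒟φ`-integrability of `e^{−S_k}`** (the joint gauge invariance `jointInvariant_rho` transports it to the axial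
gauge: p34's `isRT311_axialRTData`, r18's `exists_isRT311` pattern). [cite: BalabanImbrieJaffe1985, (6.1) p.318] -/
theorem exists_isRT311_eq61_of_integrable (a : ℝ) (ha : 0 < a)
    (hI : Integrable (uncurry (s.rho a ha)) ((fieldMeasure P (0 + s.k) U1).prod volume)) :
    ∃ ρ₁ : GaugeField P (0 + s.k + 1) U1 → HiggsField P (0 + s.k + 1) → ℂ,
      IsRT311 qU s.qH a (s.rho a ha) ρ₁ ∧ Integrable (uncurry ρ₁) ((fieldMeasure P (0 + s.k + 1) U1).prod volume) :=
  ⟨_, isRT311_axialRTData s.hj ha s.hd2 measurable_qU s.measurable_qH (absolutelyContinuous_map_qU s.hj)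
      (s.measurable_rho a ha) (s.jointInvariant_rho a ha) hI,
    integrable_rt_of_integrable_ax
      (D := axialRTData s.hj qU measurable_qU s.qH s.measurable_qH (absolutelyContinuous_map_qU s.hj))
      (A := gaussApprox ha s.hd2) (s.measurable_rho a ha)
      (integrable_comp_ax (s.measurable_rho a ha) (s.jointInvariant_rho a ha) hI)⟩

/-- kernel: **a small-field restriction makes `e^{−S_k}` integrable, unconditionally** — for every jointly measurable `χ(u, φ)` with `|χ| ≤ 1`
that vanishes unless `|φ(x)| ≤ R` at every site, the restricted density `χ·e^{−S_k}` is `𝒟u𝒟φ`-integrable in the axial gauge (`e^{−S_k} ≤ 1` by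
`norm_rho_le_one`, `𝒟u` a probability measure, a bounded box in `φ`). [cite: BalabanImbrieJaffe1985, (6.1) p.318] -/
theorem integrable_smallField_ax [DecidableEq (PBond P (0 + s.k))] (a : ℝ) (ha : 0 < a)
    {χ : GaugeField P (0 + s.k) U1 → HiggsField P (0 + s.k) → ℂ} (hχm : Measurable (uncurry χ)) (hχ1 : ∀ u φ, ‖χ u φ‖ ≤ 1) {R : ℝ}
    (hχR : ∀ u φ, χ u φ ≠ 0 → ∀ x, ‖φ x‖ ≤ R) :
    Integrable (uncurry fun U φ => χ (fixBonds axialBonds U) φ * s.rho a ha (fixBonds axialBonds U) φ)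
      ((fieldMeasure P (0 + s.k) U1).prod volume) := by
  set box : Set (HiggsField P (0 + s.k)) := Set.pi Set.univ fun _ => Metric.closedBall (0 : ℂ) R with hbox_def
  have hbox : MeasurableSet box := MeasurableSet.univ_pi fun _ => Metric.isClosed_closedBall.measurableSet
  have hμS : ((fieldMeasure P (0 + s.k) U1).prod volume) (Set.univ ×ˢ box) ≠ ⊤ := by
    rw [Measure.prod_prod, measure_univ, one_mul, hbox_def, volume_pi_pi]
    exact ENNReal.prod_ne_top fun x _ => measure_closedBall_lt_top.ne
  have hax : Measurable fun p : GaugeField P (0 + s.k) U1 × HiggsField P (0 + s.k) => (fixBonds axialBonds p.1, p.2) :=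
    ((measurable_fixBonds _).comp measurable_fst).prodMk measurable_snd
  have hf : Measurable (uncurry fun U φ => χ (fixBonds axialBonds U) φ * s.rho a ha (fixBonds axialBonds U) φ) :=
    ((hχm.comp hax).mul ((s.measurable_rho a ha).comp hax) :)
  have hb : ∀ p : GaugeField P (0 + s.k) U1 × HiggsField P (0 + s.k),
      ‖uncurry (fun U φ => χ (fixBonds axialBonds U) φ * s.rho a ha (fixBonds axialBonds U) φ) p‖ ≤ 1 := fun p => by
    rw [uncurry, norm_mul]
    exact mul_le_one₀ (hχ1 _ _) (norm_nonneg _) (s.norm_rho_le_one a ha _ _)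
  have hon := Measure.integrableOn_of_bounded hμS hf.aestronglyMeasurable (ae_of_all _ hb)
  refine hon.integrable_of_forall_notMem_eq_zero fun p hp => ?_
  have hp2 : p.2 ∉ box := fun h => hp ⟨Set.mem_univ _, h⟩
  have hχ0 : χ (fixBonds axialBonds p.1) p.2 = 0 := by
    by_contra hne
    exact hp2 (Set.mem_univ_pi.2 fun x => mem_closedBall_zero_iff.2 (hχR _ _ hne x))
  show χ (fixBonds axialBonds p.1) p.2 * s.rho a ha (fixBonds axialBonds p.1) p.2 = 0
  rw [hχ0, zero_mul]

/-- **(6.1) ON A SMALL-FIELD REGION — HYPOTHESIS-FREE.**  p. 318: *"The integral (6.1) will be studied in detail in later papers by dividing it into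
small and large field regions, defined by some restrictions on the range of φ and u. In this paper we are concerned with the small field regions
which give the dominant contributions to the integral."*  For EVERY jointly measurable restriction `χ(u, φ)`, `|χ| ≤ 1`, supported in a bounded
`φ`-range (`χ(u, φ) ≠ 0 ⇒ |φ(x)| ≤ R`), the transform `ρ₁ = 𝒯(χe^{−S_k})` of (3.3) EXISTS, is `dv dψ`-integrable and satisfies r18's typed (6.1),
`IsRT311 qU (Q(u_k)·) a (χe^{−S_k}) ρ₁` — no analytic premise (`a > 0`, standing range only). [cite: BalabanImbrieJaffe1985, (6.1) p.318] -/
theorem isRT311_eq61_smallField (a : ℝ) (ha : 0 < a) {χ : GaugeField P (0 + s.k) U1 → HiggsField P (0 + s.k) → ℂ}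
    (hχm : Measurable (uncurry χ)) (hχ1 : ∀ u φ, ‖χ u φ‖ ≤ 1) {R : ℝ} (hχR : ∀ u φ, χ u φ ≠ 0 → ∀ x, ‖φ x‖ ≤ R) :
    ∃ ρ₁ : GaugeField P (0 + s.k + 1) U1 → HiggsField P (0 + s.k + 1) → ℂ,
      IsRT311 qU s.qH a (fun u φ => χ u φ * s.rho a ha u φ) ρ₁ ∧ Integrable (uncurry ρ₁) ((fieldMeasure P (0 + s.k + 1) U1).prod volume) := by
  classical
  have hm : Measurable (uncurry fun u φ => χ u φ * s.rho a ha u φ) := (hχm.mul (s.measurable_rho a ha) :)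
  exact s.exists_isRT311_of_integrable_ax ha hm (s.integrable_smallField_ax a ha hχm hχ1 hχR)

/-- **(3.7) at the `k`-th step** — *"The integral (3.2) therefore has the normalization property ∫𝒯e^{−S}𝒟v𝒟ψ = ∫e^{−S}𝒟u𝒟φ, (3.7)"* — for EVERY
density `ρ₁` that (6.1) defines (`IsRT311 qU (Q(u_k)·) a e^{−S_k} ρ₁`, `a > 0`): `∫dv dψ ρ₁ = ∫𝒟u𝒟φ e^{−S_k}` (r18's `integral_eq_of_isRT311`;
gauge invariance of `u ↦ ∫𝒟φ e^{−S_k(u,φ)}` from `jointInvariant_rho` by `BIJ85RT33.gaugeInvariant_integral`). [cite: BalabanImbrieJaffe1985, (3.7) p.306] -/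
theorem integral_rho1_eq61 (a : ℝ) (ha : 0 < a) {ρ₁ : GaugeField P (0 + s.k + 1) U1 → HiggsField P (0 + s.k + 1) → ℂ}
    (h : IsRT311 qU s.qH a (s.rho a ha) ρ₁) :
    ∫ v, ∫ ψ, ρ₁ v ψ ∂volume ∂fieldMeasure P (0 + s.k + 1) U1 = ∫ U, ∫ φ, s.rho a ha U φ ∂volume ∂fieldMeasure P (0 + s.k) U1 :=
  integral_eq_of_isRT311 s.hj s.hd2 ha h (s.measurable_rho a ha)
    (gaugeInvariant_integral (s.measurable_rho a ha) (s.jointInvariant_rho a ha))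

/-! ## §6  Print's integral (6.1) CONVERGES: for every `u` and every `ψ` the `φ`-integrand is integrable

The located gap (module docstring) concerns the `𝒟u𝒟φ`-integrability of `e^{−S_k}` ALONE.  The integrand print writes — `e^{−S_k(u,φ)}` TIMES
the Gaussian `δ_H(ψ − Q(u_k)φ)` — is `𝒟φ`-integrable for EVERY unit-lattice field `u` and every `ψ`: the form `½⟨φ, Δ_k(u_k)φ⟩ + t‖Q(u_k)φ‖²`
(`t > 0`) is positive definite, because `⟨φ, Δ_k(u_k)φ⟩ = 0` forces `φ = Q_k(u_k)χ` with `χ` covariantly constant and then `Q(u_k)φ =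
Q_{k+1}(u_k)χ ≠ 0` unless `χ = 0` (p11's `eq_zero_of_covD_eq_zero_of_qCovK_eq_zero`); a positive definite form on a finite-dimensional space is
coercive, and the integrand is dominated by a product of one-site Gaussians. -/

/-- kernel: **`⟨φ, Δ_k(u_k(u))φ⟩ = 0` and `Q(u_k(u))φ = 0` force `φ = 0`** (the value `½⟨φ, Δ_kφ⟩` is attained at the minimizer `ψ_k = a_kG_kQ_k^*φ`
of (4.6.1), p. 313; a vanishing minimum makes `ψ_k` covariantly constant with `Q_kψ_k = φ`, and `Q(u_k)Q_k(u_k) = Q_{k+1}(u_k)` has no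
covariantly constant kernel — p11's no-zero-modes theorem at level `k + 1`). [cite: BalabanImbrieJaffe1985, (4.6.2) p.313] -/
theorem eq_zero_of_scalarPart_eq_zero (a : ℝ) (ha : 0 < a) (u : GaugeField P (0 + s.k) U1) (φ : HiggsField P (0 + s.k))
    (h1 : scalarPart a ha (s.idx u) (WithLp.toLp 2 φ : CoarseSpK P 0 s.k) = 0) (h2 : s.qH u φ = 0) : φ = 0 := by
  have hG := s.Gk_spec a ha u
  have hval := scalarForm_phiCl hG (WithLp.toLp 2 φ : CoarseSpK P 0 s.k)
  rw [← scalarPart_idx, h1, scalarForm] at hval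
  set χ := phiCl (QlinK (s.uk u) s.k) (aK a P.L s.k) (s.Gk a ha u) (WithLp.toLp 2 φ : CoarseSpK P 0 s.k) with hχ_def
  have haK := s.aK_pos ha u
  have hA := sq_nonneg ‖QlinK (s.uk u) s.k χ - WithLp.toLp 2 φ‖
  have hB := sq_nonneg ‖Dlin (cPhys P s.k) (s.uk u) χ‖
  have hQ : ‖QlinK (s.uk u) s.k χ - WithLp.toLp 2 φ‖ ^ 2 = 0 := by nlinarith
  have hD : ‖Dlin (cPhys P s.k) (s.uk u) χ‖ ^ 2 = 0 := by nlinarith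
  rw [sq_eq_zero_iff, norm_eq_zero, sub_eq_zero] at hQ
  rw [sq_eq_zero_iff, norm_eq_zero] at hD
  have hcov : ∀ b, BIJ88Sect3Statements.covD (cPhys P s.k) (cfg (s.uk u)) (WithLp.ofLp χ) b = 0 := fun b => by
    rw [← BIJ85ScalarPropagatorTorus.Dlin_apply, hD]
    rfl
  have hφ : φ = qCovK (s.uk u) s.k (WithLp.ofLp χ) := by
    funext y
    rw [← BIJ85BlockAveragesTorusK.QlinK_apply, hQ]
  have hQk1 : ∀ y : TSite P (0 + (s.k + 1)), qCovK (s.uk u) (s.k + 1) (WithLp.ofLp χ) y = 0 := fun y => by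
    show qCov (lineIter (s.uk u) s.k) (qCovK (s.uk u) s.k (WithLp.ofLp χ)) y = 0
    rw [← hφ]
    exact congrFun h2 y
  have hχ0 : WithLp.ofLp χ = 0 :=
    eq_zero_of_covD_eq_zero_of_qCovK_eq_zero (cPhys_pos P s.k).ne' hcov (s.k + 1) (by have := s.hk; omega) hQk1
  rw [hφ, hχ0]
  funext y
  rw [qCovK_apply]
  simp

/-- kernel: `Q(u_k)` is real-homogeneous. [cite: BalabanImbrieJaffe1985, (2.6) p.303] -/
theorem qH_smul (u : GaugeField P (0 + s.k) U1) (c : ℝ) (φ : HiggsField P (0 + s.k)) : s.qH u (c • φ) = c • s.qH u φ := by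
  funext y
  rw [qH_apply, Pi.smul_apply, qH_apply, Complex.real_smul, Finset.mul_sum, Finset.mul_sum, Finset.mul_sum]
  refine Finset.sum_congr rfl fun x _ => ?_
  rw [Pi.smul_apply, Complex.real_smul]
  ring

/-- kernel: the scalar part is real-homogeneous of degree two. [cite: BalabanImbrieJaffe1985, (4.6.4) p.313] -/
theorem scalarPart_idx_smul (a : ℝ) (ha : 0 < a) (u : GaugeField P (0 + s.k) U1) (c : ℝ) (ψ : CoarseSpK P 0 s.k) :
    scalarPart a ha (s.idx u) (c • ψ) = c ^ 2 * scalarPart a ha (s.idx u) ψ := by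
  rw [scalarPart_idx, scalarPart_idx, map_smul, real_inner_smul_left, real_inner_smul_right]
  ring

/-- THE CONFINING FORM of the (6.1) integrand at fixed `u`: `½⟨ψ, Δ_k(u_k)ψ⟩ + t·Σ_y|(Q(u_k)ψ)(y)|²` on the unit-lattice scalar fields (`ℓ²` carrier).
[cite: BalabanImbrieJaffe1985, (6.1) p.318] -/
def cForm (a : ℝ) (ha : 0 < a) (u : GaugeField P (0 + s.k) U1) (t : ℝ) (ψ : CoarseSpK P 0 s.k) : ℝ :=
  scalarPart a ha (s.idx u) ψ + t * ∑ y, ‖s.qH u (WithLp.ofLp ψ) y‖ ^ 2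

/-- kernel: the confining form is continuous. [cite: BalabanImbrieJaffe1985, (6.1) p.318] -/
theorem continuous_cForm (a : ℝ) (ha : 0 < a) (u : GaugeField P (0 + s.k) U1) (t : ℝ) : Continuous (s.cForm a ha u t) := by
  have hΔ : Continuous (deltaOp (QlinK (s.uk u) s.k) (aK a P.L s.k) (s.Gk a ha u)) := LinearMap.continuous_of_finiteDimensional _
  have h1 : Continuous fun ψ : CoarseSpK P 0 s.k => scalarPart a ha (s.idx u) ψ := by
    have h : (fun ψ : CoarseSpK P 0 s.k => scalarPart a ha (s.idx u) ψ) =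
        fun ψ => (1 / 2 : ℝ) * ⟪ψ, deltaOp (QlinK (s.uk u) s.k) (aK a P.L s.k) (s.Gk a ha u) ψ⟫ :=
      funext (s.scalarPart_idx a ha u)
    rw [h]
    exact (continuous_id.inner hΔ).const_mul _
  have h2 : ∀ y, Continuous fun ψ : CoarseSpK P 0 s.k => s.qH u (WithLp.ofLp ψ) y := fun y => by
    have h : (fun ψ : CoarseSpK P 0 s.k => s.qH u (WithLp.ofLp ψ) y) =
        fun ψ => ((P.L : ℂ) ^ P.d)⁻¹ * ∑ x ∈ block y, holC (lineIter (s.uk u) s.k) x * (WithLp.ofLp ψ) x :=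
      funext fun ψ => s.qH_apply u _ y
    rw [h]
    exact continuous_const.mul (continuous_finsetSum _ fun x _ => continuous_const.mul (PiLp.continuous_apply 2 _ x))
  unfold cForm
  exact h1.add (continuous_const.mul (continuous_finsetSum _ fun y _ => ((h2 y).norm.pow 2)))

/-- kernel: homogeneity `cForm (c•ψ) = c²·cForm ψ`. [cite: BalabanImbrieJaffe1985, (6.1) p.318] -/
theorem cForm_smul (a : ℝ) (ha : 0 < a) (u : GaugeField P (0 + s.k) U1) (t c : ℝ) (ψ : CoarseSpK P 0 s.k) :
    s.cForm a ha u t (c • ψ) = c ^ 2 * s.cForm a ha u t ψ := by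
  unfold cForm
  rw [scalarPart_idx_smul, WithLp.ofLp_smul, qH_smul, Finset.mul_sum, mul_add, Finset.mul_sum, Finset.mul_sum]
  congr 1
  refine Finset.sum_congr rfl fun y _ => ?_
  rw [Pi.smul_apply, norm_smul, mul_pow, Real.norm_eq_abs, sq_abs]
  ring

/-- kernel: the confining form is non-negative. [cite: BalabanImbrieJaffe1985, (6.1) p.318] -/
theorem cForm_nonneg (a : ℝ) (ha : 0 < a) (u : GaugeField P (0 + s.k) U1) {t : ℝ} (ht : 0 ≤ t) (ψ : CoarseSpK P 0 s.k) :
    0 ≤ s.cForm a ha u t ψ := by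
  have h1 : 0 ≤ scalarPart a ha (s.idx u) ψ := by
    rw [scalarPart_idx_eq_iInf]
    exact le_ciInf fun χ => s.sForm_nonneg (s.aK_pos ha u).le _ _ χ
  exact add_nonneg h1 (mul_nonneg ht (Finset.sum_nonneg fun y _ => sq_nonneg _))

/-- **THE CONFINING FORM IS POSITIVE DEFINITE** (`t > 0`): `cForm ψ = 0 ⇒ ψ = 0` (`eq_zero_of_scalarPart_eq_zero`). [cite: BalabanImbrieJaffe1985, (6.1) p.318] -/
theorem cForm_eq_zero (a : ℝ) (ha : 0 < a) (u : GaugeField P (0 + s.k) U1) {t : ℝ} (ht : 0 < t) {ψ : CoarseSpK P 0 s.k}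
    (h : s.cForm a ha u t ψ = 0) : ψ = 0 := by
  have h1 : 0 ≤ scalarPart a ha (s.idx u) ψ := by
    rw [scalarPart_idx_eq_iInf]
    exact le_ciInf fun χ => s.sForm_nonneg (s.aK_pos ha u).le _ _ χ
  have h2 : 0 ≤ ∑ y, ‖s.qH u (WithLp.ofLp ψ) y‖ ^ 2 := Finset.sum_nonneg fun y _ => sq_nonneg _
  unfold cForm at h
  have hs : scalarPart a ha (s.idx u) ψ = 0 := by nlinarith [mul_nonneg ht.le h2]
  have hq : ∑ y, ‖s.qH u (WithLp.ofLp ψ) y‖ ^ 2 = 0 := by nlinarith [mul_nonneg ht.le h2]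
  have hq' : s.qH u (WithLp.ofLp ψ) = 0 := by
    funext y
    have := (Finset.sum_eq_zero_iff_of_nonneg fun y _ => sq_nonneg _).1 hq y (Finset.mem_univ y)
    rwa [sq_eq_zero_iff, norm_eq_zero] at this
  have h0 : WithLp.ofLp ψ = 0 := s.eq_zero_of_scalarPart_eq_zero a ha u (WithLp.ofLp ψ) hs hq'
  exact (WithLp.ofLp_eq_zero (p := 2)).1 h0

/-- **COERCIVITY**: for `t > 0` there is `c > 0` with `c‖ψ‖² ≤ cForm ψ` for all `ψ` (positive definite + continuous + homogeneous on a
finite-dimensional space: minimum over the compact unit sphere). [cite: BalabanImbrieJaffe1985, (6.1) p.318] -/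
theorem cForm_coercive (a : ℝ) (ha : 0 < a) (u : GaugeField P (0 + s.k) U1) {t : ℝ} (ht : 0 < t) :
    ∃ c : ℝ, 0 < c ∧ ∀ ψ : CoarseSpK P 0 s.k, c * ‖ψ‖ ^ 2 ≤ s.cForm a ha u t ψ := by
  by_cases hS : (Metric.sphere (0 : CoarseSpK P 0 s.k) 1).Nonempty
  · obtain ⟨ψ₀, hψ₀, hmin⟩ :=
      (isCompact_sphere (0 : CoarseSpK P 0 s.k) 1).exists_isMinOn hS (s.continuous_cForm a ha u t).continuousOn
    have hψ₀1 : ‖ψ₀‖ = 1 := by simpa using hψ₀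
    have hc : 0 < s.cForm a ha u t ψ₀ := by
      rcases (s.cForm_nonneg a ha u ht.le ψ₀).lt_or_eq with h | h
      · exact h
      · exfalso
        have := s.cForm_eq_zero a ha u ht h.symm
        rw [this, norm_zero] at hψ₀1
        exact zero_ne_one hψ₀1
    refine ⟨_, hc, fun ψ => ?_⟩
    by_cases hψ : ψ = 0
    · subst hψ
      rw [norm_zero, zero_pow two_ne_zero, mul_zero]
      exact s.cForm_nonneg a ha u ht.le 0
    · have hn : ‖ψ‖ ≠ 0 := norm_ne_zero_iff.2 hψ
      have hmem : ‖ψ‖⁻¹ • ψ ∈ Metric.sphere (0 : CoarseSpK P 0 s.k) 1 := by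
        rw [mem_sphere_zero_iff_norm, norm_smul, norm_inv, norm_norm, inv_mul_cancel₀ hn]
      have hle := hmin hmem
      rw [Set.mem_setOf_eq, cForm_smul] at hle
      have hpos : 0 < ‖ψ‖ ^ 2 := by positivity
      calc s.cForm a ha u t ψ₀ * ‖ψ‖ ^ 2 ≤ ‖ψ‖⁻¹ ^ 2 * s.cForm a ha u t ψ * ‖ψ‖ ^ 2 :=
            mul_le_mul_of_nonneg_right hle hpos.le
        _ = s.cForm a ha u t ψ := by field_simp
  · refine ⟨1, one_pos, fun ψ => ?_⟩
    have hψ : ψ = 0 := by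
      by_contra h
      exact hS ⟨‖ψ‖⁻¹ • ψ, by
        rw [mem_sphere_zero_iff_norm, norm_smul, norm_inv, norm_norm, inv_mul_cancel₀ (norm_ne_zero_iff.2 h)]⟩
    subst hψ
    rw [norm_zero, zero_pow two_ne_zero, mul_zero]
    exact s.cForm_nonneg a ha u ht.le 0

/-- kernel (the Gaussian `δ_H` against the quadratic growth of its centre): `δ_H(ψ − c) ≤ exp(½wΣ|ψ|² − E^{(0)})·exp(−¼wΣ|c|²)`,
`w = aL^{d−2}` (from `|c|² ≤ 2|ψ − c|² + 2|ψ|²`). [cite: BalabanImbrieJaffe1985, (3.6) p.306] -/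
theorem gaussWeight_le {j : ℕ} {a : ℝ} (ha : 0 ≤ a) (c ψ : HiggsField P (j + 1)) :
    gaussWeight a c ψ ≤ Real.exp ((1 / 2 : ℝ) * (a * (P.L : ℝ)⁻¹ ^ 2 * (P.L : ℝ) ^ P.d) * (∑ y, ‖ψ y‖ ^ 2)
        - BIJ88Sect3Statements.E0step (Fintype.card (TSite P (j + 1))) a P.L P.d)
      * Real.exp (-((1 / 4 : ℝ) * (a * (P.L : ℝ)⁻¹ ^ 2 * (P.L : ℝ) ^ P.d)) * ∑ y, ‖c y‖ ^ 2) := by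
  rw [gaussWeight, ← Real.exp_add]
  refine Real.exp_le_exp.2 ?_
  set w : ℝ := a * (P.L : ℝ)⁻¹ ^ 2 * (P.L : ℝ) ^ P.d with hw_def
  have hw : 0 ≤ w := by positivity
  have hsum : ∑ y, (P.L : ℝ) ^ P.d * ‖ψ y - c y‖ ^ 2 = (P.L : ℝ) ^ P.d * ∑ y, ‖ψ y - c y‖ ^ 2 := by rw [Finset.mul_sum]
  have hy : ∀ y, ‖c y‖ ^ 2 ≤ 2 * ‖ψ y - c y‖ ^ 2 + 2 * ‖ψ y‖ ^ 2 := fun y => by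
    have h1 : ‖c y‖ ≤ ‖ψ y - c y‖ + ‖ψ y‖ := by
      have := norm_sub_le (ψ y) (ψ y - c y)
      rw [sub_sub_cancel] at this
      linarith
    nlinarith [sq_nonneg (‖ψ y - c y‖ - ‖ψ y‖), norm_nonneg (c y), norm_nonneg (ψ y - c y), norm_nonneg (ψ y)]
  have hS : ∑ y, ‖c y‖ ^ 2 ≤ 2 * ∑ y, ‖ψ y - c y‖ ^ 2 + 2 * ∑ y, ‖ψ y‖ ^ 2 := by
    rw [Finset.mul_sum, Finset.mul_sum, ← Finset.sum_add_distrib]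
    exact Finset.sum_le_sum fun y _ => hy y
  rw [hsum]
  have := mul_le_mul_of_nonneg_left hS hw
  nlinarith

/-- kernel: the one-site complex Gaussian is integrable (`∫_ℂ e^{−c|z|²}d²z = π/c`). [cite: BalabanImbrieJaffe1988, (3.12) p.267] -/
theorem integrable_exp_neg_mul_sq_norm {c : ℝ} (hc : 0 < c) : Integrable fun z : ℂ => Real.exp (-c * ‖z‖ ^ 2) := by
  refine Integrable.of_integral_ne_zero ?_
  rw [GaussianFourier.integral_rexp_neg_mul_sq_norm hc]
  exact (Real.rpow_pos_of_pos (div_pos Real.pi_pos hc) _).ne'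

/-- kernel: the `φ`-integrand of (6.1) at fixed `(u, ψ)` is measurable. [cite: BalabanImbrieJaffe1985, (6.1) p.318] -/
theorem measurable_integrand61 (a : ℝ) (ha : 0 < a) (u : GaugeField P (0 + s.k) U1) (ψ : HiggsField P (0 + s.k + 1)) :
    Measurable fun φ : HiggsField P (0 + s.k) => s.integrand61 a ha u φ ψ := by
  have h1 : Measurable fun φ : HiggsField P (0 + s.k) => s.rho a ha u φ :=
    ((s.measurable_rho a ha).comp (measurable_const.prodMk measurable_id) :)
  have h2 : Measurable fun φ : HiggsField P (0 + s.k) => s.qH u φ :=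
    (s.measurable_qH.comp (measurable_const.prodMk measurable_id) :)
  have h3 : Measurable fun φ : HiggsField P (0 + s.k) => gaussWeight a (s.qH u φ) ψ :=
    ((BIJ88RT311Exists.measurable_gaussWeight a).comp (h2.prodMk measurable_const) :)
  unfold integrand61
  exact h1.mul (Complex.measurable_ofReal.comp h3)

/-- **PRINT'S INTEGRAL (6.1) CONVERGES** — for EVERY unit-lattice gauge field `u` (axial gauge or not), every `ψ` and `a > 0`, the `φ`-integrand
`e^{−S_k(u,φ)}·δ_H(ψ − Q(u_k)φ)` is `𝒟φ`-integrable: dominated by `e^{K(ψ)}Π_x e^{−c|φ(x)|²}` with the coercivity constant `c` of the confining form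
at `t = ¼aL^{d−2}`.  (The outer `𝒟u`-integration is over a compact group; what is NOT proved here — and not printed — is the `𝒟u𝒟φ`-integrability of
`e^{−S_k}` alone, see the HONEST SCOPE.) [cite: BalabanImbrieJaffe1985, (6.1) p.318] -/
theorem integrable_integrand61 (a : ℝ) (ha : 0 < a) (u : GaugeField P (0 + s.k) U1) (ψ : HiggsField P (0 + s.k + 1)) :
    Integrable fun φ : HiggsField P (0 + s.k) => s.integrand61 a ha u φ ψ := by
  set w : ℝ := a * (P.L : ℝ)⁻¹ ^ 2 * (P.L : ℝ) ^ P.d with hw_def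
  have hw : 0 < w := by
    have := P.cast_L_pos
    positivity
  obtain ⟨c, hc, hcoer⟩ := s.cForm_coercive a ha u (t := (1 / 4 : ℝ) * w) (by positivity)
  set K : ℝ := (1 / 2 : ℝ) * w * (∑ y, ‖ψ y‖ ^ 2)
    - BIJ88Sect3Statements.E0step (Fintype.card (TSite P (0 + s.k + 1))) a P.L P.d with hK_def
  -- the dominating product of one-site Gaussians
  have hdom : Integrable (fun φ : HiggsField P (0 + s.k) => Real.exp K * ∏ x, Real.exp (-c * ‖φ x‖ ^ 2)) := by
    have h := Integrable.fintype_prod (ι := TSite P (0 + s.k)) (μ := fun _ => (volume : Measure ℂ))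
      (f := fun _ z => Real.exp (-c * ‖z‖ ^ 2)) fun _ => integrable_exp_neg_mul_sq_norm hc
    exact (h.const_mul (Real.exp K) :)
  refine hdom.mono' (s.measurable_integrand61 a ha u ψ).aestronglyMeasurable (ae_of_all _ fun φ => ?_)
  -- the pointwise bound
  have hnorm : ‖s.integrand61 a ha u φ ψ‖ = Real.exp (-s.Sk a ha u φ) * gaussWeight a (s.qH u φ) ψ := by
    rw [integrand61, norm_mul, norm_rho, Complex.norm_real, Real.norm_eq_abs, abs_of_pos (BIJ88RenormTransf311.gaussWeight_pos _ _ _)]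
  rw [hnorm]
  have hS : Real.exp (-s.Sk a ha u φ) ≤ Real.exp (-scalarPart a ha (s.idx u) (WithLp.toLp 2 φ : CoarseSpK P 0 s.k)) := by
    refine Real.exp_le_exp.2 (neg_le_neg ?_)
    show scalarPart a ha (s.idx u) (WithLp.toLp 2 φ : CoarseSpK P 0 s.k) ≤ gaugePart (s.idx u) + scalarPart a ha (s.idx u) _
    linarith [gaugePart_nonneg (s.idx u)]
  have hG := gaussWeight_le (P := P) (j := 0 + s.k) ha.le (s.qH u φ) ψ
  have hcφ := hcoer (WithLp.toLp 2 φ)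
  have hnsq : ‖(WithLp.toLp 2 φ : CoarseSpK P 0 s.k)‖ ^ 2 = ∑ x, ‖φ x‖ ^ 2 := by
    rw [PiLp.norm_sq_eq_of_L2]
  have hprod : ∏ x, Real.exp (-c * ‖φ x‖ ^ 2) = Real.exp (-(c * ∑ x, ‖φ x‖ ^ 2)) := by
    rw [Finset.mul_sum, ← Finset.sum_neg_distrib, Real.exp_sum]
    refine Finset.prod_congr rfl fun x _ => ?_
    rw [neg_mul]
  rw [hprod]
  calc Real.exp (-s.Sk a ha u φ) * gaussWeight a (s.qH u φ) ψ
      ≤ Real.exp (-scalarPart a ha (s.idx u) (WithLp.toLp 2 φ : CoarseSpK P 0 s.k)) *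
          (Real.exp K * Real.exp (-((1 / 4 : ℝ) * w) * ∑ y, ‖s.qH u φ y‖ ^ 2)) :=
        mul_le_mul hS hG (BIJ88RenormTransf311.gaussWeight_pos _ _ _).le (Real.exp_pos _).le
    _ = Real.exp K * Real.exp (-(s.cForm a ha u ((1 / 4 : ℝ) * w) (WithLp.toLp 2 φ))) := by
        rw [cForm, WithLp.ofLp_toLp, neg_add, Real.exp_add]
        ring_nf
    _ ≤ Real.exp K * Real.exp (-(c * ∑ x, ‖φ x‖ ^ 2)) := by
        refine mul_le_mul_of_nonneg_left (Real.exp_le_exp.2 (neg_le_neg ?_)) (Real.exp_pos _).le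
        rw [← hnsq]
        exact hcφ

end Step61

end

end Literature.MathematicalPhysics.QuantumFieldTheory.BalabanImbrieJaffe1984to88.BIJ85Eq61MeanFieldRT
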